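import Literature.Analysis.FluidPDE.PassiveVectorTensorFluxAntisymm
import HarnessLib

/-!
# Two-problem duality for weak passive solenoidal vectors with constant viscosity tensors: the
# pairing of a solution of problem 1 with an ADJOINT solution of problem 2, with its cross terms

Analysis/FluidPDE proof-support file (everything proved; no definitions, no named facts). Let `u` be a
weak solution of the class `Torus.IsWeakTensorPassiveVectorOn 0 T 𝔸₁ b₁ u₀ u` (problem 1:
`∂ₜu + (b₁·∇)u + ∇π = 𝓛_{𝔸₁} u`, `∇·u = 0`) and, for `0 < t₀ ≤ T`, let `ψ` be a weak solution on
`(0,t₀)` of the same class with the transposed tensor `𝔸₂ᵀ = Torus.majorTranspose 𝔸₂`, the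
time-reversed carrier `r ↦ −b₂(t₀ − r)` and datum `φ` — the ADJOINT of problem 2 (tensor `𝔸₂`,
carrier `b₂`) written forward in `r = t₀ − s`. For tensors in a Legendre–Hadamard window
`NearIso 𝔸ᵢ lo hi`, `0 < lo`, essentially bounded carriers and `L²` weakly divergence-free data:

* `IsWeakTensorPassiveVectorOn.exists_integrableOn_hasSum_cross` — **the pairing
  `s ↦ ∫⟪u(s), ψ(t₀ − s)⟫` is, for a.e. `s ∈ (0,t₀)`, a constant plus `∫_{(0,s]} G`**, where `G` is
  integrable on `(0,t₀)` and is, at a.e. time `σ`, the (absolutely convergent) sum over the modes of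
  the CROSS TERMS
  `Re( −4π² ⟪û(σ)(k), (T_{𝔸₁}(k) − T_{𝔸₂}(k)) ψ̂(t₀−σ)(k)⟫ + Σⱼ 2πikⱼ (⟪𝓕(b₁ⱼ u(σ))(k), ψ̂(t₀−σ)(k)⟫ − ⟪û(σ)(k), 𝓕(b₂ⱼ ψ(t₀−σ))(k)⟫) )`
  (viscous cross term: the symbol of `𝔸₁ − 𝔸₂`; transport cross term: `b₁` on `u` against `b₂` on
  `ψ`). With `𝔸₁ = 𝔸₂`, `b₁ = b₂` the sum vanishes (`PassiveVectorTensorFluxAntisymm`) and this is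
  `PassiveVectorTensorDuality.exists_ae_integral_inner_reversed_eq_const`.
  Proof = the Fourier–Galerkin proof of that theorem (Temam 1984, Ch. III Lemma 1.2: the product rule
  `d/dt (u, v) = ⟨u', v⟩ + ⟨u, v'⟩`, polarised, for the truncations) KEEPING the cross terms: the
  tested modes are absolutely continuous, the product formula for complex primitives makes
  `Σ_{|k|≤N} Re⟪û(s)(k), ψ̂(t₀−s)(k)⟫` a primitive whose derivative at a.e. `σ` is the finite sum over
  `|k| ≤ N` of the cross terms (`T_{𝔸₂ᵀ}(k)` is the adjoint of `T_{𝔸₂}(k)`,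
  `inner_symbT_majorTranspose_left`); the finite sums converge to `G(σ)` and are dominated, uniformly
  in `N`, by an integrable function of `σ` built from the two dissipation densities `‖∇u(σ)‖²`,
  `‖∇ψ(t₀−σ)‖²` (finite in time integral: `eVectorDissipation_lt_top`) and the energies
  (`summable_re_cross_and_abs_sum_le`: explicit symbol bound `‖T_𝔸(k)z‖ ≤ ‖𝔸‖₁|k|²‖z‖`, AM–GM and
  Parseval), so dominated convergence in time passes to the limit; Parseval identifies the limit of
  the truncated pairings with `∫⟪u(s), ψ(t₀ − s)⟫` at a.e. `s`.
* `IsWeakTensorPassiveVectorOn.exists_integrableOn_hasSum_cross_traces` — **endpoint form**: the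
  constant is `h(t₀)` for every continuous representative `h` of `r ↦ ∫⟪ψ(r), u₀⟫`, and
  `g(t₀) = c + ∫_{(0,t₀]} G` for every continuous representative `g` of `t ↦ ∫⟪u(t), φ⟫`; hence
  "`⟨u(t₀), φ⟩ − ⟨u₀, ψ(t₀)⟩ = ∫₀^{t₀} G`" (strong `L²` initial traces, as in
  `PassiveVectorTensorDuality.exists_const_ae_integral_inner_reversed_eq`).
* `IsWeakTensorPassiveVectorOn.exists_ae_integral_inner_reversed_eq_add_setIntegral_tsum` (the
  identity with the mode sum written as a `tsum`); `exists_integrableOn_hasSum_cross_sub_traces`,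
  `twoProblemDuality` (crux binder shape, `tsum`) and `twoProblemDuality_traces` — the SPLIT form:
  modewise `𝓕(b₁ⱼu) = 𝓕((b₁ⱼ − b₂ⱼ)u) + 𝓕(b₂ⱼu)` and the equal-carrier flux (`b₂` on `u` against
  `b₂` on `ψ`) sums to zero at a.e. time by `Torus.hasSum_re_fourierFlux`, so only the carrier
  DIFFERENCE `b₁ − b₂` remains in the transport cross term.
* `Torus.summable_re_cross_and_abs_sum_le` — the cross family at one time is summable with partial
  sums bounded by `(‖𝔸₁‖₁ + ‖𝔸₂‖₁ + 1)(‖∇u‖² + ‖∇v‖²) + π d (M₁²‖u‖² + M₂²‖v‖²)`.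

Cell `ad-ideate`, K1L_D (stmt-AnomalousDissipation-27980) memo L7 brick Z1′ (`Lines/onelevel_Z_bricks.lean`,
lead-k1l-onelevel-p1 g3: consumer (Z1) with `b₁ − b₂ = b_{m+1}`, `𝔸₁ − 𝔸₂ = −𝔼`); the private scalar /
orthonormal-basis / reflection helpers are copies of those of `PassiveVectorTensorDuality`.

## Mathlib / tree search

Tree: `PassiveVectorTensorDuality` (the one-problem road and its public bricks
`inner_symbT_majorTranspose_left`, `memLp_top_stLift_reversed`, `abs_le_of_ae_abs_le_of_continuousOn`),
`PassiveVectorTensorFluxAntisymm` (`hasSum_re_fourierFlux`), `PassiveVectorTensorFourier`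
(`ae_inner_mFourierCoeff_eq`, `integrableOn_modeRHS`, `symbT_apply`), `PassiveVectorTensorUniqueness`
(`mem_orthogonal_waveVec_iff`, `ae_sum_mul_mFourierCoeff_eq_zero`), `PassiveVectorTensorClass` (slice API),
`PassiveVectorTensorDissipationBound` (`eVectorDissipation_lt_top`), `PassiveVectorTensorEnergyDecay`
(`ae_integral_norm_sq_le`, `exists_modulus_integral_norm_sq_sub_of_nearIso`), `NSHopfLimit`
(`Torus.aemeasurable_eGradNormSq_of_coeff`), `NSUniqueness2HalfDEstimates`
(`Torus.aestronglyMeasurable_mFourierCoeff_complexify_slice`), `TorusVectorParseval`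
(`hasSum_sq_norm_mFourierCoeff_complexify`, `hasSum_re_inner_mFourierCoeff_complexify`, `mFourierCoeff_congr_ae`),
`TorusSpectralWeakDerivative` (`eGradNormSq_eq_tsum`), `TorusTrigPoly` (`mFourierCoeff_sub`),
`TorusSobolevNormProofs` (`mFourierCoeff_neg`), `TorusTimeAverage` (`IsWeaklyDivFree.congr_ae`),
`PassiveScalarEnergyProofs` (`ae_ae_norm_le_of_memLp_top_stLift`). Mathlib:
`tendsto_integral_of_dominated_convergence`, `aestronglyMeasurable_of_tendsto_ae`,
`integrable_toReal_of_lintegral_ne_top`, `Measure.restrict_congr_set`, `Ioo_ae_eq_Ioc`,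
`intervalIntegral.continuousOn_primitive`.

## References

* R. Temam, *Navier–Stokes Equations*, 3rd ed. (North-Holland 1984), Ch. III §1, Lemma 1.2
  (`u ∈ L²(V)`, `u' ∈ L²(V')` ⇒ `d/dt|u|² = 2⟨u', u⟩`; polarised for two functions) and Lemma 1.4.
  [`Temam1984`]
* J. C. Robinson, J. L. Rodrigo, W. Sadowski, *The three-dimensional Navier–Stokes equations*
  (CUP 2016), §4.1–§4.2 (Galerkin truncations, (4.20)). [`RobinsonRodrigoSadowski2016`]
* S. Kuksin, A. Shirikyan, *Mathematics of two-dimensional turbulence* (CUP 2012), Prop. 2.1.7,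
  (2.11)–(2.12) (antisymmetry of the trilinear form). [`KuksinShirikyan2012`]
* U. Frisch, *Turbulence* (CUP 1995), §9.6.3 eq. (9.57) p. 233 (anisotropic eddy viscosity).
  [`Frisch1995Turbulence`]
* L. Grafakos, *Classical Fourier Analysis*, 3rd ed. (Springer 2014), Prop. 3.2.7 (Parseval). [`Grafakos2014`]
-/

noncomputable section

open MeasureTheory Set Filter Function TopologicalSpace Complex UnitAddTorus
open scoped ENNReal NNReal InnerProductSpace Topology ComplexConjugate

namespace Literature.Analysis.FluidPDE

namespace Torus

variable {d : Type*} [Fintype d] [DecidableEq d]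

/-! ## Scalar lemmas: products of complex primitives, time reversal (copies of the private helpers of
`PassiveVectorTensorDuality`) -/

section Scalar

omit [Fintype d] [DecidableEq d] in
/-- **Fubini on a triangle, complex-valued.** For `f, g : ℝ → ℂ` integrable on `(a, b]`,
`∫_{(a,b]} f(s) (∫_{(a,s]} g) ds + ∫_{(a,b]} g(r) (∫_{(a,r]} f) dr = (∫_{(a,b]} f) (∫_{(a,b]} g)`. [folklore] -/
private theorem setIntegral_mul_setIntegral_add_symm_complex₁₂ {a b : ℝ} {f g : ℝ → ℂ}
    (hf : IntegrableOn f (Ioc a b)) (hg : IntegrableOn g (Ioc a b)) :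
    (∫ s in Ioc a b, f s * ∫ r in Ioc a s, g r) + (∫ r in Ioc a b, g r * ∫ s in Ioc a r, f s) =
      (∫ s in Ioc a b, f s) * ∫ r in Ioc a b, g r := by
  set μ : Measure ℝ := volume.restrict (Ioc a b) with hμ
  have hprod : Integrable (fun z : ℝ × ℝ => f z.1 * g z.2) (μ.prod μ) := hf.mul_prod hg
  have hS : MeasurableSet {z : ℝ × ℝ | z.2 ≤ z.1} := measurableSet_le measurable_snd measurable_fst
  rw [← integral_prod_mul (μ := μ) (ν := μ) f g,
    ← indicator_self_add_compl {z : ℝ × ℝ | z.2 ≤ z.1} (fun z : ℝ × ℝ => f z.1 * g z.2),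
    integral_add' (hprod.indicator hS) (hprod.indicator hS.compl)]
  congr 1
  · rw [integral_prod _ (hprod.indicator hS)]
    refine integral_congr_ae ?_
    filter_upwards [ae_restrict_mem measurableSet_Ioc] with s hs
    have h1 : (fun r => {z : ℝ × ℝ | z.2 ≤ z.1}.indicator (fun z : ℝ × ℝ => f z.1 * g z.2) (s, r)) =
        fun r => f s * (Iic s).indicator g r := by
      funext r
      by_cases hr : r ≤ s
      · rw [indicator_of_mem (show (s, r) ∈ {z : ℝ × ℝ | z.2 ≤ z.1} from hr),
          indicator_of_mem (show r ∈ Iic s from hr)]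
      · rw [indicator_of_notMem (show (s, r) ∉ {z : ℝ × ℝ | z.2 ≤ z.1} from hr),
          indicator_of_notMem (show r ∉ Iic s from hr), mul_zero]
    have hset : Ioc a b ∩ Iic s = Ioc a s := by
      ext r
      simp only [mem_inter_iff, mem_Ioc, mem_Iic]
      constructor
      · rintro ⟨⟨h1, -⟩, h3⟩
        exact ⟨h1, h3⟩
      · rintro ⟨h1, h2⟩
        exact ⟨⟨h1, h2.trans hs.2⟩, h2⟩
    rw [h1, MeasureTheory.integral_const_mul, hμ, setIntegral_indicator measurableSet_Iic, hset]
  · rw [integral_prod_symm _ (hprod.indicator hS.compl)]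
    refine integral_congr_ae ?_
    filter_upwards [ae_restrict_mem measurableSet_Ioc] with r hr
    have h1 : (fun s => {z : ℝ × ℝ | z.2 ≤ z.1}ᶜ.indicator (fun z : ℝ × ℝ => f z.1 * g z.2) (s, r)) =
        fun s => g r * (Iio r).indicator f s := by
      funext s
      by_cases hs : s < r
      · rw [indicator_of_mem (show (s, r) ∈ {z : ℝ × ℝ | z.2 ≤ z.1}ᶜ from not_le.2 hs),
          indicator_of_mem (show s ∈ Iio r from hs), mul_comm]
      · rw [indicator_of_notMem (show (s, r) ∉ {z : ℝ × ℝ | z.2 ≤ z.1}ᶜ from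
            fun h => h (not_lt.1 hs)),
          indicator_of_notMem (show s ∉ Iio r from hs), mul_zero]
    have hset : Ioc a b ∩ Iio r = Ioo a r := by
      ext s
      simp only [mem_inter_iff, mem_Ioc, mem_Iio, mem_Ioo]
      constructor
      · rintro ⟨⟨h1, -⟩, h3⟩
        exact ⟨h1, h3⟩
      · rintro ⟨h1, h2⟩
        exact ⟨⟨h1, h2.le.trans hr.2⟩, h2⟩
    rw [h1, MeasureTheory.integral_const_mul, hμ, setIntegral_indicator measurableSet_Iio, hset,
      integral_Ioc_eq_integral_Ioo]

omit [Fintype d] [DecidableEq d] in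
/-- **Product formula for complex primitives**: if `F(t) = α + ∫_{(0,t]} φ` and `G(t) = β + ∫_{(0,t]} γ`
on `(0, T]` with `φ, γ ∈ L¹(0,T; ℂ)`, then `F(t)G(t) = αβ + ∫_{(0,t]} (φ G + F γ)` for `t ∈ (0, T]`,
the integrand being integrable. [folklore] -/
private theorem mul_eq_add_setIntegral_of_eq_add_setIntegral_complex₁₂ {T : ℝ} {F G φ γ : ℝ → ℂ} {α β : ℂ}
    (hφ : IntegrableOn φ (Ioo 0 T)) (hγ : IntegrableOn γ (Ioo 0 T))
    (hF : ∀ t ∈ Ioc 0 T, F t = α + ∫ s in Ioc 0 t, φ s)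
    (hG : ∀ t ∈ Ioc 0 T, G t = β + ∫ s in Ioc 0 t, γ s) {t : ℝ} (ht : t ∈ Ioc 0 T) :
    IntegrableOn (fun s => φ s * G s + F s * γ s) (Ioc 0 t) ∧
      F t * G t = α * β + ∫ s in Ioc 0 t, (φ s * G s + F s * γ s) := by
  have hsub : Ioc 0 t ⊆ Ioc 0 T := Ioc_subset_Ioc_right ht.2
  have hφT : IntegrableOn φ (Ioc 0 T) := (integrableOn_Ioc_iff_integrableOn_Ioo (f := φ)).2 hφ
  have hγT : IntegrableOn γ (Ioc 0 T) := (integrableOn_Ioc_iff_integrableOn_Ioo (f := γ)).2 hγ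
  have hφt : IntegrableOn φ (Ioc 0 t) := hφT.mono_set hsub
  have hγt : IntegrableOn γ (Ioc 0 t) := hγT.mono_set hsub
  set Φ : ℝ → ℂ := fun s => ∫ r in Ioc 0 s, φ r with hΦ
  set Γ : ℝ → ℂ := fun s => ∫ r in Ioc 0 s, γ r with hΓ
  have hΦc : ContinuousOn Φ (Icc 0 t) :=
    intervalIntegral.continuousOn_primitive ((integrableOn_Icc_iff_integrableOn_Ioc (f := φ)).2 hφt)
  have hΓc : ContinuousOn Γ (Icc 0 t) :=
    intervalIntegral.continuousOn_primitive ((integrableOn_Icc_iff_integrableOn_Ioc (f := γ)).2 hγt)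
  obtain ⟨CΦ, hCΦ⟩ := isCompact_Icc.exists_bound_of_continuousOn hΦc
  obtain ⟨CΓ, hCΓ⟩ := isCompact_Icc.exists_bound_of_continuousOn hΓc
  have hΦm : AEStronglyMeasurable Φ (volume.restrict (Ioc 0 t)) :=
    (hΦc.mono Ioc_subset_Icc_self).aestronglyMeasurable measurableSet_Ioc
  have hΓm : AEStronglyMeasurable Γ (volume.restrict (Ioc 0 t)) :=
    (hΓc.mono Ioc_subset_Icc_self).aestronglyMeasurable measurableSet_Ioc
  have hΦb : ∀ᵐ s ∂(volume.restrict (Ioc 0 t)), ‖Φ s‖ ≤ CΦ :=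
    (ae_restrict_mem measurableSet_Ioc).mono fun s hs => hCΦ s (Ioc_subset_Icc_self hs)
  have hΓb : ∀ᵐ s ∂(volume.restrict (Ioc 0 t)), ‖Γ s‖ ≤ CΓ :=
    (ae_restrict_mem measurableSet_Ioc).mono fun s hs => hCΓ s (Ioc_subset_Icc_self hs)
  have i1 : IntegrableOn (fun s => φ s * Γ s) (Ioc 0 t) := by
    have h := hφt.bdd_mul hΓm hΓb
    exact h.congr (ae_of_all _ fun s => mul_comm _ _)
  have i2 : IntegrableOn (fun s => γ s * Φ s) (Ioc 0 t) := by
    have h := hγt.bdd_mul hΦm hΦb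
    exact h.congr (ae_of_all _ fun s => mul_comm _ _)
  have hG' : ∀ᵐ s ∂(volume.restrict (Ioc 0 t)), φ s * G s = β * φ s + φ s * Γ s :=
    (ae_restrict_mem measurableSet_Ioc).mono fun s hs => by rw [hG s (hsub hs)]; ring
  have hF' : ∀ᵐ s ∂(volume.restrict (Ioc 0 t)), F s * γ s = α * γ s + γ s * Φ s :=
    (ae_restrict_mem measurableSet_Ioc).mono fun s hs => by rw [hF s (hsub hs)]; ring
  have j1 : IntegrableOn (fun s => φ s * G s) (Ioc 0 t) :=
    ((hφt.const_mul β).add i1).congr (hG'.mono fun s hs => hs.symm)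
  have j2 : IntegrableOn (fun s => F s * γ s) (Ioc 0 t) :=
    ((hγt.const_mul α).add i2).congr (hF'.mono fun s hs => hs.symm)
  refine ⟨j1.add j2, ?_⟩
  rw [integral_add j1 j2, integral_congr_ae hG', integral_congr_ae hF',
    integral_add (hφt.const_mul β) i1, integral_add (hγt.const_mul α) i2, MeasureTheory.integral_const_mul,
    MeasureTheory.integral_const_mul, hF t ht, hG t ht]
  have key := setIntegral_mul_setIntegral_add_symm_complex₁₂ hφt hγt
  calc (α + Φ t) * (β + Γ t) = α * β + (β * Φ t + α * Γ t + Φ t * Γ t) := by ring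
    _ = α * β + (β * Φ t + (∫ s in Ioc 0 t, φ s * Γ s) + (α * Γ t + ∫ s in Ioc 0 t, γ s * Φ s)) := by
        rw [hΦ, hΓ]
        dsimp only
        rw [← key]
        ring

omit [Fintype d] [DecidableEq d] in
/-- Time reversal `s ↦ t₀ - s` is measure preserving on Lebesgue measure. [folklore] -/
private theorem measurePreserving_sub_left₁₂ (t₀ : ℝ) :
    MeasurePreserving (fun s : ℝ => t₀ - s) volume volume :=
  Measure.measurePreserving_sub_left volume t₀

omit [Fintype d] [DecidableEq d] in
/-- Time reversal is a measurable embedding. [folklore] -/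
private theorem measurableEmbedding_sub_left₁₂ (t₀ : ℝ) :
    MeasurableEmbedding (fun s : ℝ => t₀ - s) :=
  (MeasurableEquiv.subLeft t₀).measurableEmbedding

omit [Fintype d] [DecidableEq d] in
/-- Time reversal maps `(0,t₀)` onto itself. [folklore] -/
private theorem preimage_sub_left_Ioo₁₂ (t₀ : ℝ) : (fun s : ℝ => t₀ - s) ⁻¹' Ioo 0 t₀ = Ioo 0 t₀ := by
  ext s
  simp only [mem_preimage, mem_Ioo]
  constructor <;> rintro ⟨h1, h2⟩ <;> constructor <;> linarith

omit [Fintype d] [DecidableEq d] in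
/-- **Time reversal of a.e. statements on `(0,t₀)`**: if `P r` holds for a.e. `r ∈ (0,t₀)` then
`P (t₀ - s)` holds for a.e. `s ∈ (0,t₀)`. [folklore] -/
private theorem ae_restrict_Ioo_comp_sub_left₁₂ {t₀ : ℝ} {P : ℝ → Prop}
    (h : ∀ᵐ r ∂(volume.restrict (Ioo 0 t₀)), P r) :
    ∀ᵐ s ∂(volume.restrict (Ioo 0 t₀)), P (t₀ - s) := by
  have h' : ∀ᵐ r ∂(volume : Measure ℝ), r ∈ Ioo 0 t₀ → P r := (ae_restrict_iff' measurableSet_Ioo).1 h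
  have h'' := (measurePreserving_sub_left₁₂ t₀).quasiMeasurePreserving.ae h'
  refine (ae_restrict_iff' measurableSet_Ioo).2 (h''.mono fun s hs hsI => hs ?_)
  have : s ∈ (fun s : ℝ => t₀ - s) ⁻¹' Ioo 0 t₀ := by rw [preimage_sub_left_Ioo₁₂]; exact hsI
  exact this

omit [Fintype d] [DecidableEq d] in
/-- Time reversal of integrability on `(0,t₀)`. [folklore] -/
private theorem integrableOn_comp_sub_left₁₂ {E : Type*} [NormedAddCommGroup E] {t₀ : ℝ} {f : ℝ → E}
    (hf : IntegrableOn f (Ioo 0 t₀)) : IntegrableOn (fun s => f (t₀ - s)) (Ioo 0 t₀) := by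
  have h := ((measurePreserving_sub_left₁₂ t₀).integrableOn_comp_preimage
    (measurableEmbedding_sub_left₁₂ t₀) (f := f) (s := Ioo 0 t₀)).2 hf
  rw [preimage_sub_left_Ioo₁₂] at h
  exact h

omit [Fintype d] [DecidableEq d] in
/-- **The reversed primitive.** For `γ ∈ L¹(0,t₀)` and `s ∈ [0,t₀]`:
`∫_{(0,t₀-s]} γ = ∫_{(0,t₀]} γ + ∫_{(0,s]} (−γ(t₀ − σ)) dσ`. [folklore] -/
private theorem setIntegral_Ioc_sub_eq₁₂ {E : Type*} [NormedAddCommGroup E] [NormedSpace ℝ E] [CompleteSpace E]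
    {t₀ : ℝ} {γ : ℝ → E} (hγ : IntegrableOn γ (Ioo 0 t₀)) {s : ℝ} (hs : s ∈ Icc 0 t₀) :
    ∫ σ in Ioc 0 (t₀ - s), γ σ = (∫ σ in Ioc 0 t₀, γ σ) + ∫ σ in Ioc 0 s, -γ (t₀ - σ) := by
  have hγI : IntegrableOn γ (Icc 0 t₀) := (integrableOn_Icc_iff_integrableOn_Ioo (f := γ)).2 hγ
  have hi : ∀ {a c : ℝ}, 0 ≤ a → a ≤ c → c ≤ t₀ → IntervalIntegrable γ volume a c := by
    intro a c ha hac hc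
    refine (hγI.mono_set ?_).intervalIntegrable
    rw [uIcc_of_le hac]
    exact Icc_subset_Icc ha hc
  have h1 : 0 ≤ t₀ - s := by linarith [hs.2]
  have h2 : t₀ - s ≤ t₀ := by linarith [hs.1]
  rw [← intervalIntegral.integral_of_le h1, ← intervalIntegral.integral_of_le (hs.1.trans hs.2),
    ← intervalIntegral.integral_of_le hs.1, intervalIntegral.integral_neg,
    intervalIntegral.integral_comp_sub_left (fun σ => γ σ) t₀, sub_zero,
    ← intervalIntegral.integral_add_adjacent_intervals (hi le_rfl h1 h2) (hi h1 h2 le_rfl)]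
  abel

omit [Fintype d] [DecidableEq d] in
/-- `∫_{(0,s₂]} f − ∫_{(0,s₁]} f = ∫_{(s₁,s₂]} f` for `0 ≤ s₁ ≤ s₂` and `f` integrable on `(0,s₂]`.
[folklore] -/
private theorem setIntegral_Ioc_sub_setIntegral_Ioc₁₂ {E : Type*} [NormedAddCommGroup E] [NormedSpace ℝ E]
    {f : ℝ → E} {s₁ s₂ : ℝ} (hf : IntegrableOn f (Ioc 0 s₂)) (h1 : 0 ≤ s₁) (h12 : s₁ ≤ s₂) :
    (∫ σ in Ioc 0 s₂, f σ) - ∫ σ in Ioc 0 s₁, f σ = ∫ σ in Ioc s₁ s₂, f σ := by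
  have hab : IntervalIntegrable f volume 0 s₂ := by
    rw [intervalIntegrable_iff, uIoc_of_le (h1.trans h12)]; exact hf
  have hac : IntervalIntegrable f volume 0 s₁ := by
    rw [intervalIntegrable_iff, uIoc_of_le h1]; exact hf.mono_set (Ioc_subset_Ioc_right h12)
  rw [← intervalIntegral.integral_of_le (h1.trans h12), ← intervalIntegral.integral_of_le h1,
    ← intervalIntegral.integral_of_le h12, intervalIntegral.integral_interval_sub_left hab hac]

omit [Fintype d] [DecidableEq d] in
/-- An a.e. nonpositivity statement for a function continuous on `[0,t₀]`, `0 < t₀`, holds everywhere on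
`[0,t₀]` (`abs_le_of_ae_abs_le_of_continuousOn` applied to the positive part). [folklore] -/
private theorem nonpos_of_ae_nonpos_of_continuousOn₁₂ {f : ℝ → ℝ} {t₀ : ℝ} (ht₀ : 0 < t₀)
    (hf : ContinuousOn f (Icc 0 t₀)) (h : ∀ᵐ s ∂(volume.restrict (Ioo 0 t₀)), f s ≤ 0) :
    ∀ s ∈ Icc 0 t₀, f s ≤ 0 := by
  have hmax : ContinuousOn (fun s => max (f s) 0) (Icc 0 t₀) := hf.sup continuousOn_const
  have hae : ∀ᵐ s ∂(volume.restrict (Ioo 0 t₀)), |max (f s) 0| ≤ 0 :=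
    h.mono fun s hs => by rw [max_eq_right hs, abs_zero]
  intro s hs
  have h0 := abs_le_of_ae_abs_le_of_continuousOn ht₀ hmax hae s hs
  have h1 : max (f s) 0 ≤ 0 := (le_abs_self _).trans h0
  exact (le_max_left _ _).trans h1

end Scalar

/-! ## Orthonormal-basis algebra in the transversal subspace (copies) -/

section Onb

omit [DecidableEq d]

/-- Pulling a scalar out of a transport sum. [folklore] -/
private theorem modeRHS_sumpull₁₂ (k : d → ℤ) (μ : ℂ) (f : d → ℂ) :
    ∑ j, (2 * Real.pi * I * (k j)) * (μ * f j) = μ * ∑ j, (2 * Real.pi * I * (k j)) * f j := by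
  rw [Finset.mul_sum]; exact Finset.sum_congr rfl fun j _ => by ring

/-- The mode right-hand side `H(z) = −4π² ⟪X, T_𝔸(k) z⟫ + B(z)` is `ℂ`-linear in `z`:
`H(Σᵢ μᵢ eᵢ) = Σᵢ μᵢ H(eᵢ)`. [folklore] -/
private theorem modeRHS_sum_smul₁₂ {ι : Type*} (s : Finset ι) (𝔸 : Visc4 d) (k : d → ℤ) (A : ℝ)
    (X : EuclideanSpace ℂ d) (F G : d → EuclideanSpace ℂ d) (μ : ι → ℂ) (e : ι → EuclideanSpace ℂ d) :
    (-(4 * Real.pi ^ 2 : ℝ) : ℂ) * ⟪X, symbT 𝔸 k (∑ i ∈ s, μ i • e i)⟫_ℂ +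
        ((∑ j, (2 * Real.pi * I * (k j)) * ⟪F j, ∑ i ∈ s, μ i • e i⟫_ℂ) +
          (A : ℂ) * ∑ j, (2 * Real.pi * I * (k j)) * ⟪G j, ∑ i ∈ s, μ i • e i⟫_ℂ) =
      ∑ i ∈ s, μ i * ((-(4 * Real.pi ^ 2 : ℝ) : ℂ) * ⟪X, symbT 𝔸 k (e i)⟫_ℂ +
        ((∑ j, (2 * Real.pi * I * (k j)) * ⟪F j, e i⟫_ℂ) + (A : ℂ) * ∑ j, (2 * Real.pi * I * (k j)) * ⟪G j, e i⟫_ℂ)) := by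
  classical
  induction s using Finset.induction_on with
  | empty => simp
  | insert a s ha ih =>
    rw [Finset.sum_insert ha, Finset.sum_insert ha, ← ih]
    simp only [symbT_add, symbT_smul, inner_add_right, inner_smul_right, mul_add, Finset.sum_add_distrib,
      modeRHS_sumpull₁₂]
    ring

/-- Expansion in a subspace with conjugated coefficients: `Σᵢ conj⟪X, eᵢ⟫ eᵢ = X` for `X ∈ S`.
[folklore] -/
private theorem sum_conj_inner_smul_onb₁₂ {ι : Type*} [Fintype ι] {S : Submodule ℂ (EuclideanSpace ℂ d)}
    (b : OrthonormalBasis ι ℂ S) {X : EuclideanSpace ℂ d} (hX : X ∈ S) :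
    ∑ i, conj ⟪X, (b i : EuclideanSpace ℂ d)⟫_ℂ • (b i : EuclideanSpace ℂ d) = X := by
  have h := b.sum_repr' ⟨X, hX⟩
  have h' := congrArg (fun v : S => (v : EuclideanSpace ℂ d)) h
  simp only [Submodule.coe_sum, Submodule.coe_smul, Submodule.coe_inner] at h'
  simp_rw [inner_conj_symm]
  exact h'

/-- The pairing through an orthonormal basis of a subspace containing the second vector:
`Σᵢ ⟪X, eᵢ⟫ conj⟪Y, eᵢ⟫ = ⟪X, Y⟫` for `Y ∈ S` and every `X`. [folklore] -/
private theorem sum_inner_mul_conj_inner_onb₁₂ {ι : Type*} [Fintype ι] {S : Submodule ℂ (EuclideanSpace ℂ d)}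
    (b : OrthonormalBasis ι ℂ S) (X : EuclideanSpace ℂ d) {Y : EuclideanSpace ℂ d} (hY : Y ∈ S) :
    ∑ i, ⟪X, (b i : EuclideanSpace ℂ d)⟫_ℂ * conj ⟪Y, (b i : EuclideanSpace ℂ d)⟫_ℂ = ⟪X, Y⟫_ℂ := by
  conv_rhs => rw [← sum_conj_inner_smul_onb₁₂ b hY]
  rw [inner_sum]
  refine Finset.sum_congr rfl fun i _ => ?_
  rw [inner_smul_right, mul_comm]

end Onb

/-! ## The cross integrand at one time: explicit symbol bound, summability, uniform bound -/

section CrossSlice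

omit [DecidableEq d]

omit [Fintype d] in
/-- `Re(2πi n · conj z) = −Re(2πi n · z)`: a purely imaginary factor flips the sign of the real part
under conjugation of the other factor. [folklore] -/
private theorem re_two_pi_I_mul_conj₁₂ (n : ℤ) (z : ℂ) :
    ((2 * Real.pi * I * (n : ℂ)) * conj z).re = -(((2 * Real.pi * I * (n : ℂ)) * z).re) := by
  simp [Complex.mul_re, Complex.mul_im, Complex.conj_re, Complex.conj_im]

omit [Fintype d] in
/-- `|Re(2πi a ⟪X, Y⟫)| ≤ 2π|a|‖X‖‖Y‖`. [folklore] -/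
private theorem abs_re_two_pi_I_mul_inner_le₁₂ {E : Type*} [NormedAddCommGroup E] [InnerProductSpace ℂ E]
    (a : ℝ) (X Y : E) :
    |((2 * Real.pi * I * (a : ℂ)) * ⟪X, Y⟫_ℂ).re| ≤ 2 * Real.pi * |a| * ‖X‖ * ‖Y‖ := by
  refine (Complex.abs_re_le_norm _).trans ?_
  rw [norm_mul]
  have h1 : ‖(2 * Real.pi * I * (a : ℂ))‖ = 2 * Real.pi * |a| := by
    rw [norm_mul, norm_mul, norm_mul, Complex.norm_I, mul_one, Complex.norm_real, Real.norm_eq_abs,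
      Complex.norm_ofNat, Complex.norm_real, Real.norm_eq_abs, abs_of_pos Real.pi_pos]
  rw [h1, mul_assoc (2 * Real.pi * |a|)]
  exact mul_le_mul_of_nonneg_left (norm_inner_le_norm X Y) (by positivity)

/-- `|k_a| |k_b| ≤ |k|²`. [folklore] -/
private theorem abs_mul_abs_le_freqNormSq₁₂ (k : d → ℤ) (a b : d) :
    |(k a : ℝ)| * |(k b : ℝ)| ≤ FunctionSpaces.Torus.freqNormSq k := by
  have ha : ((k a : ℝ)) ^ 2 ≤ FunctionSpaces.Torus.freqNormSq k := by
    unfold FunctionSpaces.Torus.freqNormSq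
    exact Finset.single_le_sum (f := fun i => ((k i : ℝ)) ^ 2) (fun i _ => sq_nonneg _) (Finset.mem_univ a)
  have hb : ((k b : ℝ)) ^ 2 ≤ FunctionSpaces.Torus.freqNormSq k := by
    unfold FunctionSpaces.Torus.freqNormSq
    exact Finset.single_le_sum (f := fun i => ((k i : ℝ)) ^ 2) (fun i _ => sq_nonneg _) (Finset.mem_univ b)
  nlinarith [two_mul_le_add_sq (|(k a : ℝ)|) (|(k b : ℝ)|), sq_abs (k a : ℝ), sq_abs (k b : ℝ),
    abs_nonneg (k a : ℝ), abs_nonneg (k b : ℝ)]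

/-- A coordinate is bounded by the Euclidean norm. [folklore] -/
private theorem norm_apply_le_norm₁₂ (z : EuclideanSpace ℂ d) (i : d) : ‖z i‖ ≤ ‖z‖ := by
  rw [EuclideanSpace.norm_eq z]
  conv_lhs => rw [← Real.sqrt_sq (norm_nonneg (z i))]
  exact Real.sqrt_le_sqrt (Finset.single_le_sum (f := fun j => ‖z j‖ ^ 2) (fun j _ => sq_nonneg _) (Finset.mem_univ i))

/-- **Explicit symbol bound**: `‖T_𝔸(k) z‖ ≤ (Σ |𝔸 i a j b|) · |k|² · ‖z‖` (`(T_𝔸(k))_{ji} = Σ_{a,b} 𝔸 i a j b k_a k_b`,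
Frisch's anisotropic eddy viscosity (9.57) on the Fourier side). [folklore] -/
private theorem norm_symbT_le_freqNormSq₁₂ (𝔸 : Visc4 d) (k : d → ℤ) (z : EuclideanSpace ℂ d) :
    ‖symbT 𝔸 k z‖ ≤ (∑ i, ∑ a, ∑ j, ∑ b, |𝔸 i a j b|) * FunctionSpaces.Torus.freqNormSq k * ‖z‖ := by
  set K : ℝ := FunctionSpaces.Torus.freqNormSq k with hK
  have hK0 : 0 ≤ K := FunctionSpaces.Torus.freqNormSq_nonneg k
  have hz0 : 0 ≤ ‖z‖ := norm_nonneg _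
  set c : d → ℝ := fun j => ∑ i, ∑ a, ∑ b, |𝔸 i a j b| with hc
  have hc0 : ∀ j, 0 ≤ c j := fun j => by rw [hc]; positivity
  have hcoord : ∀ j, ‖symbT 𝔸 k z j‖ ≤ c j * K * ‖z‖ := by
    intro j
    rw [symbT_apply]
    calc ‖∑ i, ∑ a, ∑ b, ((𝔸 i a j b * (k a : ℝ) * (k b : ℝ) : ℝ) : ℂ) * z i‖
        ≤ ∑ i, ∑ a, ∑ b, ‖((𝔸 i a j b * (k a : ℝ) * (k b : ℝ) : ℝ) : ℂ) * z i‖ := by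
          refine (norm_sum_le _ _).trans (Finset.sum_le_sum fun i _ => ?_)
          refine (norm_sum_le _ _).trans (Finset.sum_le_sum fun a _ => ?_)
          exact norm_sum_le _ _
      _ ≤ ∑ i, ∑ a, ∑ b, |𝔸 i a j b| * K * ‖z‖ := by
          refine Finset.sum_le_sum fun i _ => Finset.sum_le_sum fun a _ => Finset.sum_le_sum fun b _ => ?_
          rw [norm_mul, Complex.norm_real, Real.norm_eq_abs, abs_mul, abs_mul, mul_assoc |𝔸 i a j b|]
          have h1 : |(k a : ℝ)| * |(k b : ℝ)| ≤ K := abs_mul_abs_le_freqNormSq₁₂ k a b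
          have h2 : ‖z i‖ ≤ ‖z‖ := norm_apply_le_norm₁₂ z i
          have h3 : 0 ≤ |𝔸 i a j b| := abs_nonneg _
          calc |𝔸 i a j b| * (|(k a : ℝ)| * |(k b : ℝ)|) * ‖z i‖ ≤ |𝔸 i a j b| * K * ‖z‖ := by
                gcongr
            _ = |𝔸 i a j b| * K * ‖z‖ := rfl
      _ = c j * K * ‖z‖ := by rw [hc]; simp only [Finset.sum_mul]
  have hsq : ‖symbT 𝔸 k z‖ ^ 2 ≤ ((∑ j, c j) * K * ‖z‖) ^ 2 := by
    rw [EuclideanSpace.norm_eq, Real.sq_sqrt (Finset.sum_nonneg fun j _ => sq_nonneg _)]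
    calc ∑ j, ‖symbT 𝔸 k z j‖ ^ 2 ≤ ∑ j, (c j * K * ‖z‖) ^ 2 :=
          Finset.sum_le_sum fun j _ => pow_le_pow_left₀ (norm_nonneg _) (hcoord j) 2
      _ = (∑ j, c j ^ 2) * (K * ‖z‖) ^ 2 := by rw [Finset.sum_mul]; exact Finset.sum_congr rfl fun j _ => by ring
      _ ≤ (∑ j, c j) ^ 2 * (K * ‖z‖) ^ 2 := by
          refine mul_le_mul_of_nonneg_right ?_ (sq_nonneg _)
          rw [sq, Finset.sum_mul]
          exact Finset.sum_le_sum fun j _ => by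
            rw [sq]
            exact mul_le_mul_of_nonneg_left (Finset.single_le_sum (fun i _ => hc0 i) (Finset.mem_univ j)) (hc0 j)
      _ = ((∑ j, c j) * K * ‖z‖) ^ 2 := by ring
  have hB0 : 0 ≤ (∑ j, c j) * K * ‖z‖ := mul_nonneg (mul_nonneg (Finset.sum_nonneg fun j _ => hc0 j) hK0) hz0
  have e : (∑ j, c j) = ∑ i, ∑ a, ∑ j, ∑ b, |𝔸 i a j b| := by
    rw [hc]; dsimp only
    rw [Finset.sum_comm]
    refine Finset.sum_congr rfl fun i _ => ?_
    rw [Finset.sum_comm]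
  rw [← e]
  exact (pow_le_pow_iff_left₀ (norm_nonneg _) hB0 two_ne_zero).1 hsq

/-- An a.e.-bounded a.e.-strongly-measurable scalar component times an `L²` field is in `L²`. [folklore] -/
private theorem memLp_two_smul_apply_ae₁₂ {c u : UnitAddTorus d → EuclideanSpace ℝ d} {M : ℝ}
    (hc : AEStronglyMeasurable c volume) (hcM : ∀ᵐ x ∂volume, ‖c x‖ ≤ M) (hu : MemLp u 2 volume) (j : d) :
    MemLp (fun x => c x j • u x) 2 volume := by
  have hcj : AEStronglyMeasurable (fun x => c x j) volume :=
    (EuclideanSpace.proj j).continuous.comp_aestronglyMeasurable hc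
  refine MemLp.of_le_mul (c := M) hu (hcj.smul hu.1) ?_
  filter_upwards [hcM] with x hx
  rw [norm_smul]
  refine mul_le_mul_of_nonneg_right ?_ (norm_nonneg _)
  rw [Real.norm_eq_abs]
  exact (FunctionSpaces.Torus.abs_apply_le_norm (c x) j).trans hx

/-- `∫ ‖cⱼ u‖² ≤ M² ∫ ‖u‖²` for an a.e.-bounded component `|cⱼ| ≤ ‖c‖ ≤ M` a.e. [folklore] -/
private theorem integral_norm_sq_smul_apply_le₁₂ {c u : UnitAddTorus d → EuclideanSpace ℝ d} {M : ℝ}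
    (hc : AEStronglyMeasurable c volume) (hcM : ∀ᵐ x ∂volume, ‖c x‖ ≤ M) (hu : MemLp u 2 volume) (j : d) :
    ∫ x, ‖c x j • u x‖ ^ 2 ≤ M ^ 2 * ∫ x, ‖u x‖ ^ 2 := by
  have hmem := memLp_two_smul_apply_ae₁₂ hc hcM hu j
  have hi1 : Integrable (fun x => ‖c x j • u x‖ ^ 2) volume := (memLp_two_iff_integrable_sq_norm hmem.1).1 hmem
  have hi2 : Integrable (fun x => ‖u x‖ ^ 2) volume := (memLp_two_iff_integrable_sq_norm hu.1).1 hu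
  rw [← MeasureTheory.integral_const_mul]
  refine integral_mono_ae hi1 (hi2.const_mul _) ?_
  filter_upwards [hcM] with x hx
  have h1 : ‖c x j‖ ≤ M := by
    rw [Real.norm_eq_abs]; exact (FunctionSpaces.Torus.abs_apply_le_norm (c x) j).trans hx
  rw [norm_smul, mul_pow]
  exact mul_le_mul_of_nonneg_right (pow_le_pow_left₀ (norm_nonneg _) h1 2) (sq_nonneg _)

/-- The terms of `eGradNormSq_eq_tsum` in real form. [folklore] -/
private theorem toReal_term_eq₁₂ (v : UnitAddTorus d → EuclideanSpace ℝ d) (k : d → ℤ) :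
    (ENNReal.ofReal (FunctionSpaces.Torus.freqNormSq k) *
        ‖mFourierCoeff (FunctionSpaces.EuclideanSpace.complexify ∘ v) k‖ₑ ^ 2).toReal
      = FunctionSpaces.Torus.freqNormSq k * ‖mFourierCoeff (FunctionSpaces.EuclideanSpace.complexify ∘ v) k‖ ^ 2 := by
  rw [ENNReal.toReal_mul, ENNReal.toReal_ofReal (FunctionSpaces.Torus.freqNormSq_nonneg k), ENNReal.toReal_pow,
    toReal_enorm]

/-- **Finite spectral gradient ⇒ summable real gradient series**, with
`Σ_k |k|²‖𝓕v(k)‖² = (eGradNormSq v).toReal / (4π²)` (`eGradNormSq_eq_tsum` read in `ℝ`). [folklore] -/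
private theorem summable_freqNormSq_mul_sq₁₂ (v : UnitAddTorus d → EuclideanSpace ℝ d)
    (h : FunctionSpaces.Torus.eGradNormSq v ≠ ⊤) :
    Summable (fun k : d → ℤ => FunctionSpaces.Torus.freqNormSq k *
        ‖mFourierCoeff (FunctionSpaces.EuclideanSpace.complexify ∘ v) k‖ ^ 2) ∧
      ∑' k : d → ℤ, FunctionSpaces.Torus.freqNormSq k * ‖mFourierCoeff (FunctionSpaces.EuclideanSpace.complexify ∘ v) k‖ ^ 2
        = (FunctionSpaces.Torus.eGradNormSq v).toReal / (4 * Real.pi ^ 2) := by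
  have hpi : ENNReal.ofReal (4 * Real.pi ^ 2) ≠ 0 := by
    rw [Ne, ENNReal.ofReal_eq_zero, not_le]; positivity
  have hS : ∑' k : d → ℤ, ENNReal.ofReal (FunctionSpaces.Torus.freqNormSq k) *
      ‖mFourierCoeff (FunctionSpaces.EuclideanSpace.complexify ∘ v) k‖ₑ ^ 2 ≠ ⊤ := by
    intro htop
    apply h
    rw [FunctionSpaces.Torus.eGradNormSq_eq_tsum, htop, ENNReal.mul_top hpi]
  have hterm : ∀ k : d → ℤ, ENNReal.ofReal (FunctionSpaces.Torus.freqNormSq k) *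
      ‖mFourierCoeff (FunctionSpaces.EuclideanSpace.complexify ∘ v) k‖ₑ ^ 2 ≠ ⊤ :=
    fun k => ENNReal.mul_ne_top ENNReal.ofReal_ne_top (ENNReal.pow_ne_top enorm_ne_top)
  have hsum := ENNReal.summable_toReal hS
  simp only [toReal_term_eq₁₂] at hsum
  refine ⟨hsum, ?_⟩
  have e1 := ENNReal.tsum_toReal_eq hterm
  simp only [toReal_term_eq₁₂] at e1
  rw [← e1, FunctionSpaces.Torus.eGradNormSq_eq_tsum, ENNReal.toReal_mul,
    ENNReal.toReal_ofReal (by positivity : (0:ℝ) ≤ 4 * Real.pi ^ 2)]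
  field_simp

/-- **The cross integrand of the two-problem duality at one time: absolute summability and a bound on
all its partial sums.** For `u, v ∈ L²(𝕋^d; ℝ^d)` with finite spectral gradient norms, carriers
`c₁, c₂` a.e. bounded by `M₁, M₂`, and constant fourth-order tensors `𝔸₁, 𝔸₂`, the mode family
`Re( −4π² ⟪û(k), (T_{𝔸₁}(k) − T_{𝔸₂}(k)) v̂(k)⟫ + Σⱼ 2πikⱼ (⟪𝓕(c₁ⱼ u)(k), v̂(k)⟫ − ⟪û(k), 𝓕(c₂ⱼ v)(k)⟫) )`
is summable and every partial sum is bounded in absolute value by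
`(‖𝔸₁‖₁ + ‖𝔸₂‖₁ + 1)(‖∇u‖² + ‖∇v‖²) + π d (M₁² ∫‖u‖² + M₂² ∫‖v‖²)` (`‖𝔸‖₁ = Σ|𝔸 i a j b|`,
`‖∇u‖² = eGradNormSq u`): termwise `‖T_𝔸(k)z‖ ≤ ‖𝔸‖₁|k|²‖z‖`, AM–GM, and Parseval for `cⱼu`, `cⱼv`
(the `N`-uniform domination used in the dominated-convergence step of Temam's Lemma III.1.2 for two
problems). [cite: Temam1984, Ch. III §1 Lemma 1.2] [cite: Grafakos2014, Prop. 3.2.7 (3)] -/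
theorem summable_re_cross_and_abs_sum_le {𝔸₁ 𝔸₂ : Visc4 d}
    {c₁ c₂ u v : UnitAddTorus d → EuclideanSpace ℝ d} {M₁ M₂ : ℝ}
    (hc₁ : AEStronglyMeasurable c₁ volume) (hc₁M : ∀ᵐ x ∂volume, ‖c₁ x‖ ≤ M₁)
    (hc₂ : AEStronglyMeasurable c₂ volume) (hc₂M : ∀ᵐ x ∂volume, ‖c₂ x‖ ≤ M₂)
    (hu : MemLp u 2 volume) (hv : MemLp v 2 volume)
    (hu1 : FunctionSpaces.Torus.eGradNormSq u ≠ ⊤) (hv1 : FunctionSpaces.Torus.eGradNormSq v ≠ ⊤) :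
    (Summable fun k : d → ℤ =>
      ((-(4 * Real.pi ^ 2 : ℝ) : ℂ) *
          ⟪mFourierCoeff (FunctionSpaces.EuclideanSpace.complexify ∘ u) k,
            symbT 𝔸₁ k (mFourierCoeff (FunctionSpaces.EuclideanSpace.complexify ∘ v) k)
              - symbT 𝔸₂ k (mFourierCoeff (FunctionSpaces.EuclideanSpace.complexify ∘ v) k)⟫_ℂ +
        ∑ j, (2 * Real.pi * I * (k j)) *
          (⟪mFourierCoeff (FunctionSpaces.EuclideanSpace.complexify ∘ fun x => c₁ x j • u x) k,
              mFourierCoeff (FunctionSpaces.EuclideanSpace.complexify ∘ v) k⟫_ℂ -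
            ⟪mFourierCoeff (FunctionSpaces.EuclideanSpace.complexify ∘ u) k,
              mFourierCoeff (FunctionSpaces.EuclideanSpace.complexify ∘ fun x => c₂ x j • v x) k⟫_ℂ)).re) ∧
    ∀ F : Finset (d → ℤ), |∑ k ∈ F,
      ((-(4 * Real.pi ^ 2 : ℝ) : ℂ) *
          ⟪mFourierCoeff (FunctionSpaces.EuclideanSpace.complexify ∘ u) k,
            symbT 𝔸₁ k (mFourierCoeff (FunctionSpaces.EuclideanSpace.complexify ∘ v) k)
              - symbT 𝔸₂ k (mFourierCoeff (FunctionSpaces.EuclideanSpace.complexify ∘ v) k)⟫_ℂ +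
        ∑ j, (2 * Real.pi * I * (k j)) *
          (⟪mFourierCoeff (FunctionSpaces.EuclideanSpace.complexify ∘ fun x => c₁ x j • u x) k,
              mFourierCoeff (FunctionSpaces.EuclideanSpace.complexify ∘ v) k⟫_ℂ -
            ⟪mFourierCoeff (FunctionSpaces.EuclideanSpace.complexify ∘ u) k,
              mFourierCoeff (FunctionSpaces.EuclideanSpace.complexify ∘ fun x => c₂ x j • v x) k⟫_ℂ)).re| ≤
      ((∑ i, ∑ a, ∑ j, ∑ b, |𝔸₁ i a j b|) + (∑ i, ∑ a, ∑ j, ∑ b, |𝔸₂ i a j b|) + 1) *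
          ((FunctionSpaces.Torus.eGradNormSq u).toReal + (FunctionSpaces.Torus.eGradNormSq v).toReal) +
        Real.pi * Fintype.card d * (M₁ ^ 2 * (∫ x, ‖u x‖ ^ 2) + M₂ ^ 2 * ∫ x, ‖v x‖ ^ 2) := by
  -- notation
  set Fu : (d → ℤ) → EuclideanSpace ℂ d := fun k => mFourierCoeff (FunctionSpaces.EuclideanSpace.complexify ∘ u) k
    with hFu
  set Fv : (d → ℤ) → EuclideanSpace ℂ d := fun k => mFourierCoeff (FunctionSpaces.EuclideanSpace.complexify ∘ v) k
    with hFv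
  set F₁ : d → (d → ℤ) → EuclideanSpace ℂ d := fun j k =>
    mFourierCoeff (FunctionSpaces.EuclideanSpace.complexify ∘ fun x => c₁ x j • u x) k with hF₁
  set F₂ : d → (d → ℤ) → EuclideanSpace ℂ d := fun j k =>
    mFourierCoeff (FunctionSpaces.EuclideanSpace.complexify ∘ fun x => c₂ x j • v x) k with hF₂
  set X : (d → ℤ) → ℝ := fun k => ((-(4 * Real.pi ^ 2 : ℝ) : ℂ) * ⟪Fu k, symbT 𝔸₁ k (Fv k) - symbT 𝔸₂ k (Fv k)⟫_ℂ +
    ∑ j, (2 * Real.pi * I * (k j)) * (⟪F₁ j k, Fv k⟫_ℂ - ⟪Fu k, F₂ j k⟫_ℂ)).re with hX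
  set A : ℝ := (∑ i, ∑ a, ∑ j, ∑ b, |𝔸₁ i a j b|) + ∑ i, ∑ a, ∑ j, ∑ b, |𝔸₂ i a j b| with hA
  have hA0 : 0 ≤ A := by rw [hA]; positivity
  set Eu : ℝ := (FunctionSpaces.Torus.eGradNormSq u).toReal with hEu
  set Ev : ℝ := (FunctionSpaces.Torus.eGradNormSq v).toReal with hEv
  have hEu0 : 0 ≤ Eu := ENNReal.toReal_nonneg
  have hEv0 : 0 ≤ Ev := ENNReal.toReal_nonneg
  -- symbol bound for the difference
  have hT : ∀ k z, ‖symbT 𝔸₁ k z - symbT 𝔸₂ k z‖ ≤ A * FunctionSpaces.Torus.freqNormSq k * ‖z‖ := by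
    intro k z
    refine (norm_sub_le _ _).trans ?_
    have h1 := norm_symbT_le_freqNormSq₁₂ 𝔸₁ k z
    have h2 := norm_symbT_le_freqNormSq₁₂ 𝔸₂ k z
    calc ‖symbT 𝔸₁ k z‖ + ‖symbT 𝔸₂ k z‖
        ≤ (∑ i, ∑ a, ∑ j, ∑ b, |𝔸₁ i a j b|) * FunctionSpaces.Torus.freqNormSq k * ‖z‖ +
          (∑ i, ∑ a, ∑ j, ∑ b, |𝔸₂ i a j b|) * FunctionSpaces.Torus.freqNormSq k * ‖z‖ := add_le_add h1 h2
      _ = A * FunctionSpaces.Torus.freqNormSq k * ‖z‖ := by rw [hA]; ring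
  -- the termwise majorant
  set m : (d → ℤ) → ℝ := fun k =>
    (2 * Real.pi ^ 2 * A + Real.pi) * (FunctionSpaces.Torus.freqNormSq k * (‖Fu k‖ ^ 2 + ‖Fv k‖ ^ 2)) +
      Real.pi * ∑ j, (‖F₁ j k‖ ^ 2 + ‖F₂ j k‖ ^ 2) with hm
  have hterm : ∀ k, |X k| ≤ m k := by
    intro k
    have hK0 : 0 ≤ FunctionSpaces.Torus.freqNormSq k := FunctionSpaces.Torus.freqNormSq_nonneg k
    -- viscous part
    have hV : |(((-(4 * Real.pi ^ 2 : ℝ) : ℂ)) * ⟪Fu k, symbT 𝔸₁ k (Fv k) - symbT 𝔸₂ k (Fv k)⟫_ℂ).re|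
        ≤ 2 * Real.pi ^ 2 * A * (FunctionSpaces.Torus.freqNormSq k * (‖Fu k‖ ^ 2 + ‖Fv k‖ ^ 2)) := by
      refine (Complex.abs_re_le_norm _).trans ?_
      rw [norm_mul]
      have h1 : ‖((-(4 * Real.pi ^ 2 : ℝ) : ℂ))‖ = 4 * Real.pi ^ 2 := by
        rw [norm_neg, Complex.norm_real, Real.norm_eq_abs, abs_of_pos (by positivity)]
      rw [h1]
      have h2 : ‖⟪Fu k, symbT 𝔸₁ k (Fv k) - symbT 𝔸₂ k (Fv k)⟫_ℂ‖ ≤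
          ‖Fu k‖ * (A * FunctionSpaces.Torus.freqNormSq k * ‖Fv k‖) :=
        (norm_inner_le_norm _ _).trans (mul_le_mul_of_nonneg_left (hT k (Fv k)) (norm_nonneg _))
      have hc0 : 0 ≤ 2 * Real.pi ^ 2 * A * FunctionSpaces.Torus.freqNormSq k :=
        mul_nonneg (mul_nonneg (by positivity) hA0) hK0
      calc 4 * Real.pi ^ 2 * ‖⟪Fu k, symbT 𝔸₁ k (Fv k) - symbT 𝔸₂ k (Fv k)⟫_ℂ‖
          ≤ 4 * Real.pi ^ 2 * (‖Fu k‖ * (A * FunctionSpaces.Torus.freqNormSq k * ‖Fv k‖)) :=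
            mul_le_mul_of_nonneg_left h2 (by positivity)
        _ = 2 * Real.pi ^ 2 * A * FunctionSpaces.Torus.freqNormSq k * (2 * ‖Fu k‖ * ‖Fv k‖) := by ring
        _ ≤ 2 * Real.pi ^ 2 * A * FunctionSpaces.Torus.freqNormSq k * (‖Fu k‖ ^ 2 + ‖Fv k‖ ^ 2) :=
            mul_le_mul_of_nonneg_left (two_mul_le_add_sq _ _) hc0
        _ = 2 * Real.pi ^ 2 * A * (FunctionSpaces.Torus.freqNormSq k * (‖Fu k‖ ^ 2 + ‖Fv k‖ ^ 2)) := by ring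
    -- transport part
    have hj : ∀ j, |((2 * Real.pi * I * (k j)) * (⟪F₁ j k, Fv k⟫_ℂ - ⟪Fu k, F₂ j k⟫_ℂ)).re|
        ≤ Real.pi * ((k j : ℝ) ^ 2 * (‖Fu k‖ ^ 2 + ‖Fv k‖ ^ 2)) + Real.pi * (‖F₁ j k‖ ^ 2 + ‖F₂ j k‖ ^ 2) := by
      intro j
      rw [mul_sub, Complex.sub_re]
      refine (abs_sub _ _).trans ?_
      have h1 := abs_re_two_pi_I_mul_inner_le₁₂ ((k j : ℤ) : ℝ) (F₁ j k) (Fv k)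
      have h2 := abs_re_two_pi_I_mul_inner_le₁₂ ((k j : ℤ) : ℝ) (Fu k) (F₂ j k)
      have e1 : ((((k j : ℤ) : ℝ) : ℂ)) = ((k j : ℤ) : ℂ) := by norm_cast
      rw [e1] at h1 h2
      have am1 : 2 * Real.pi * |((k j : ℤ) : ℝ)| * ‖F₁ j k‖ * ‖Fv k‖ ≤
          Real.pi * (((k j : ℝ)) ^ 2 * ‖Fv k‖ ^ 2 + ‖F₁ j k‖ ^ 2) := by
        have := two_mul_le_add_sq (|((k j : ℤ) : ℝ)| * ‖Fv k‖) ‖F₁ j k‖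
        rw [mul_pow, sq_abs] at this
        nlinarith [Real.pi_pos, this]
      have am2 : 2 * Real.pi * |((k j : ℤ) : ℝ)| * ‖Fu k‖ * ‖F₂ j k‖ ≤
          Real.pi * (((k j : ℝ)) ^ 2 * ‖Fu k‖ ^ 2 + ‖F₂ j k‖ ^ 2) := by
        have := two_mul_le_add_sq (|((k j : ℤ) : ℝ)| * ‖Fu k‖) ‖F₂ j k‖
        rw [mul_pow, sq_abs] at this
        nlinarith [Real.pi_pos, this]
      nlinarith [h1, h2, am1, am2]
    have hTr : |(∑ j, (2 * Real.pi * I * (k j)) * (⟪F₁ j k, Fv k⟫_ℂ - ⟪Fu k, F₂ j k⟫_ℂ)).re|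
        ≤ Real.pi * (FunctionSpaces.Torus.freqNormSq k * (‖Fu k‖ ^ 2 + ‖Fv k‖ ^ 2)) +
          Real.pi * ∑ j, (‖F₁ j k‖ ^ 2 + ‖F₂ j k‖ ^ 2) := by
      rw [Complex.re_sum]
      refine (Finset.abs_sum_le_sum_abs _ _).trans ?_
      calc ∑ j, |((2 * Real.pi * I * (k j)) * (⟪F₁ j k, Fv k⟫_ℂ - ⟪Fu k, F₂ j k⟫_ℂ)).re|
          ≤ ∑ j, (Real.pi * ((k j : ℝ) ^ 2 * (‖Fu k‖ ^ 2 + ‖Fv k‖ ^ 2)) + Real.pi * (‖F₁ j k‖ ^ 2 + ‖F₂ j k‖ ^ 2)) :=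
            Finset.sum_le_sum fun j _ => hj j
        _ = Real.pi * (FunctionSpaces.Torus.freqNormSq k * (‖Fu k‖ ^ 2 + ‖Fv k‖ ^ 2)) +
              Real.pi * ∑ j, (‖F₁ j k‖ ^ 2 + ‖F₂ j k‖ ^ 2) := by
            rw [Finset.sum_add_distrib, ← Finset.mul_sum, ← Finset.mul_sum, ← Finset.sum_mul]
            rfl
    rw [hX, hm]
    dsimp only
    rw [Complex.add_re]
    refine (abs_add_le _ _).trans ?_
    linarith [hV, hTr]
  have hm_nn : ∀ k, 0 ≤ m k := fun k => (abs_nonneg _).trans (hterm k)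
  -- the majorant is summable, with an explicit sum
  obtain ⟨hSu, hSu_eq⟩ := summable_freqNormSq_mul_sq₁₂ u hu1
  obtain ⟨hSv, hSv_eq⟩ := summable_freqNormSq_mul_sq₁₂ v hv1
  have hP₁ : ∀ j, HasSum (fun k => ‖F₁ j k‖ ^ 2) (∫ x, ‖c₁ x j • u x‖ ^ 2) := fun j =>
    FunctionSpaces.Torus.hasSum_sq_norm_mFourierCoeff_complexify (memLp_two_smul_apply_ae₁₂ hc₁ hc₁M hu j)
  have hP₂ : ∀ j, HasSum (fun k => ‖F₂ j k‖ ^ 2) (∫ x, ‖c₂ x j • v x‖ ^ 2) := fun j =>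
    FunctionSpaces.Torus.hasSum_sq_norm_mFourierCoeff_complexify (memLp_two_smul_apply_ae₁₂ hc₂ hc₂M hv j)
  have hU : HasSum (fun k => FunctionSpaces.Torus.freqNormSq k * ‖Fu k‖ ^ 2) (Eu / (4 * Real.pi ^ 2)) := by
    rw [hEu, ← hSu_eq]; exact hSu.hasSum
  have hVv : HasSum (fun k => FunctionSpaces.Torus.freqNormSq k * ‖Fv k‖ ^ 2) (Ev / (4 * Real.pi ^ 2)) := by
    rw [hEv, ← hSv_eq]; exact hSv.hasSum
  have h1 : HasSum (fun k => FunctionSpaces.Torus.freqNormSq k * (‖Fu k‖ ^ 2 + ‖Fv k‖ ^ 2))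
      (Eu / (4 * Real.pi ^ 2) + Ev / (4 * Real.pi ^ 2)) := by
    have e : (fun k => FunctionSpaces.Torus.freqNormSq k * (‖Fu k‖ ^ 2 + ‖Fv k‖ ^ 2)) =
        fun k => FunctionSpaces.Torus.freqNormSq k * ‖Fu k‖ ^ 2 + FunctionSpaces.Torus.freqNormSq k * ‖Fv k‖ ^ 2 :=
      funext fun k => by ring
    rw [e]
    exact hU.add hVv
  have h2 : HasSum (fun k => ∑ j, (‖F₁ j k‖ ^ 2 + ‖F₂ j k‖ ^ 2))
      (∑ j, ((∫ x, ‖c₁ x j • u x‖ ^ 2) + ∫ x, ‖c₂ x j • v x‖ ^ 2)) :=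
    hasSum_sum fun j _ => (hP₁ j).add (hP₂ j)
  have hHm : HasSum m ((2 * Real.pi ^ 2 * A + Real.pi) * (Eu / (4 * Real.pi ^ 2) + Ev / (4 * Real.pi ^ 2)) +
      Real.pi * ∑ j, ((∫ x, ‖c₁ x j • u x‖ ^ 2) + ∫ x, ‖c₂ x j • v x‖ ^ 2)) :=
    (h1.mul_left _).add (h2.mul_left _)
  have hms : Summable m := hHm.summable
  -- the value of the majorant sum is below the stated bound
  have hI₁ : ∀ j, ∫ x, ‖c₁ x j • u x‖ ^ 2 ≤ M₁ ^ 2 * ∫ x, ‖u x‖ ^ 2 := fun j =>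
    integral_norm_sq_smul_apply_le₁₂ hc₁ hc₁M hu j
  have hI₂ : ∀ j, ∫ x, ‖c₂ x j • v x‖ ^ 2 ≤ M₂ ^ 2 * ∫ x, ‖v x‖ ^ 2 := fun j =>
    integral_norm_sq_smul_apply_le₁₂ hc₂ hc₂M hv j
  have hval : (2 * Real.pi ^ 2 * A + Real.pi) * (Eu / (4 * Real.pi ^ 2) + Ev / (4 * Real.pi ^ 2)) +
      Real.pi * ∑ j, ((∫ x, ‖c₁ x j • u x‖ ^ 2) + ∫ x, ‖c₂ x j • v x‖ ^ 2) ≤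
      (A + 1) * (Eu + Ev) + Real.pi * Fintype.card d * (M₁ ^ 2 * (∫ x, ‖u x‖ ^ 2) + M₂ ^ 2 * ∫ x, ‖v x‖ ^ 2) := by
    have hpi := Real.pi_gt_three
    have hq : (2 * Real.pi ^ 2 * A + Real.pi) * (Eu / (4 * Real.pi ^ 2) + Ev / (4 * Real.pi ^ 2)) ≤
        (A + 1) * (Eu + Ev) := by
      rw [← add_div, ← mul_div_assoc, div_le_iff₀ (by positivity)]
      have hS0 : 0 ≤ Eu + Ev := add_nonneg hEu0 hEv0
      nlinarith [mul_nonneg hA0 hS0, mul_nonneg (mul_nonneg hA0 hS0) (sq_nonneg Real.pi), hS0,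
        mul_nonneg hS0 (sq_nonneg Real.pi)]
    have hsum : ∑ j, ((∫ x, ‖c₁ x j • u x‖ ^ 2) + ∫ x, ‖c₂ x j • v x‖ ^ 2) ≤
        Fintype.card d * (M₁ ^ 2 * (∫ x, ‖u x‖ ^ 2) + M₂ ^ 2 * ∫ x, ‖v x‖ ^ 2) := by
      calc ∑ j, ((∫ x, ‖c₁ x j • u x‖ ^ 2) + ∫ x, ‖c₂ x j • v x‖ ^ 2)
          ≤ ∑ _j : d, (M₁ ^ 2 * (∫ x, ‖u x‖ ^ 2) + M₂ ^ 2 * ∫ x, ‖v x‖ ^ 2) :=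
            Finset.sum_le_sum fun j _ => add_le_add (hI₁ j) (hI₂ j)
        _ = Fintype.card d * (M₁ ^ 2 * (∫ x, ‖u x‖ ^ 2) + M₂ ^ 2 * ∫ x, ‖v x‖ ^ 2) := by
            rw [Finset.sum_const, Finset.card_univ, nsmul_eq_mul]
    have := mul_le_mul_of_nonneg_left hsum Real.pi_pos.le
    rw [← mul_assoc] at this
    linarith
  refine ⟨Summable.of_norm_bounded hms fun k => (Real.norm_eq_abs _).le.trans (hterm k), fun F => ?_⟩
  calc |∑ k ∈ F, X k| ≤ ∑ k ∈ F, |X k| := Finset.abs_sum_le_sum_abs _ _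
    _ ≤ ∑ k ∈ F, m k := Finset.sum_le_sum fun k _ => hterm k
    _ ≤ ∑' k, m k := hms.sum_le_tsum F fun k _ => hm_nn k
    _ = _ := hHm.tsum_eq
    _ ≤ _ := hval
    _ = _ := by rw [hA]

/-- `Torus.hasSum_re_fourierFlux` (the Fourier transport flux of a bounded measurable weakly
divergence-free carrier sums to zero) under the a.e. hypotheses delivered by the weak classes: an a.e.
bounded, a.e. strongly measurable carrier is modified on a null set into a bounded measurable one with
the same Fourier products. [cite: KuksinShirikyan2012, Prop. 2.1.7 (2.11)] -/
private theorem hasSum_re_fourierFlux_ae₁₂ [DecidableEq d] {c u v : UnitAddTorus d → EuclideanSpace ℝ d} {M : ℝ}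
    (hM : 0 ≤ M) (hc : AEStronglyMeasurable c volume) (hcM : ∀ᵐ x ∂volume, ‖c x‖ ≤ M)
    (hcdiv : FunctionSpaces.Torus.IsWeaklyDivFree c) (hu : MemLp u 2 volume) (hv : MemLp v 2 volume)
    (hu1 : Summable fun k : d → ℤ =>
      FunctionSpaces.Torus.freqNormSq k * ‖mFourierCoeff (FunctionSpaces.EuclideanSpace.complexify ∘ u) k‖ ^ 2)
    (hv1 : Summable fun k : d → ℤ =>
      FunctionSpaces.Torus.freqNormSq k * ‖mFourierCoeff (FunctionSpaces.EuclideanSpace.complexify ∘ v) k‖ ^ 2) :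
    HasSum (fun k : d → ℤ => (∑ j, (2 * Real.pi * I * (k j)) *
        (⟪mFourierCoeff (FunctionSpaces.EuclideanSpace.complexify ∘ fun x => c x j • u x) k,
            mFourierCoeff (FunctionSpaces.EuclideanSpace.complexify ∘ v) k⟫_ℂ -
          ⟪mFourierCoeff (FunctionSpaces.EuclideanSpace.complexify ∘ u) k,
            mFourierCoeff (FunctionSpaces.EuclideanSpace.complexify ∘ fun x => c x j • v x) k⟫_ℂ)).re) 0 := by
  classical
  -- a bounded measurable representative of the carrier
  set c₀ : UnitAddTorus d → EuclideanSpace ℝ d := hc.mk c with hc₀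
  have hc₀m : StronglyMeasurable c₀ := hc.stronglyMeasurable_mk
  have hcc₀ : c =ᵐ[volume] c₀ := hc.ae_eq_mk
  set c' : UnitAddTorus d → EuclideanSpace ℝ d := fun x => if ‖c₀ x‖ ≤ M then c₀ x else 0 with hc'
  have hc'm : Measurable c' := by
    refine Measurable.ite ?_ hc₀m.measurable measurable_const
    exact measurableSet_le hc₀m.norm.measurable measurable_const
  have hc'M : ∀ x, ‖c' x‖ ≤ M := by
    intro x
    by_cases h : ‖c₀ x‖ ≤ M
    · rw [hc']; dsimp only; rw [if_pos h]; exact h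
    · rw [hc']; dsimp only; rw [if_neg h, norm_zero]; exact hM
  have hcc' : c =ᵐ[volume] c' := by
    filter_upwards [hcc₀, hcM] with x hx hxM
    rw [hc']; dsimp only
    rw [hx] at hxM
    rw [if_pos hxM]; exact hx
  have hc'div : FunctionSpaces.Torus.IsWeaklyDivFree c' := hcdiv.congr_ae hcc'
  have key := hasSum_re_fourierFlux hc'M hc'm hc'div hu hv hu1 hv1
  have e₁ : ∀ j k, mFourierCoeff (FunctionSpaces.EuclideanSpace.complexify ∘ fun x => c' x j • u x) k =
      mFourierCoeff (FunctionSpaces.EuclideanSpace.complexify ∘ fun x => c x j • u x) k := by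
    intro j k
    refine FunctionSpaces.Torus.mFourierCoeff_congr_ae ?_ k
    filter_upwards [hcc'] with x hx
    simp only [Function.comp_apply, hx]
  have e₂ : ∀ j k, mFourierCoeff (FunctionSpaces.EuclideanSpace.complexify ∘ fun x => c' x j • v x) k =
      mFourierCoeff (FunctionSpaces.EuclideanSpace.complexify ∘ fun x => c x j • v x) k := by
    intro j k
    refine FunctionSpaces.Torus.mFourierCoeff_congr_ae ?_ k
    filter_upwards [hcc'] with x hx
    simp only [Function.comp_apply, hx]
  simp only [e₁, e₂] at key
  exact key

/-- A weakly divergence-free field stays weakly divergence free under negation (linearity of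
`∫⟪u, ∇θ⟫`). [folklore] -/
private theorem isWeaklyDivFree_of_neg₁₂ {c : UnitAddTorus d → EuclideanSpace ℝ d}
    (h : FunctionSpaces.Torus.IsWeaklyDivFree (-c)) : FunctionSpaces.Torus.IsWeaklyDivFree c := by
  intro θ hθ
  have h1 := h θ hθ
  simp only [Pi.neg_apply, inner_neg_left, integral_neg, neg_eq_zero] at h1
  exact h1

/-- **Splitting off the equal-carrier flux at one time.** If the unsplit cross family (carrier `c₁`
on `u` against `c₂` on `v`) has sum `g`, `c₂` is a.e. bounded, a.e. strongly measurable and weakly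
divergence free, `u, v ∈ L²` have finite spectral gradient norms and the products `c₁ⱼu` are
integrable, then the SPLIT family — the transport term carrying only the carrier difference
`(c₁ⱼ − c₂ⱼ)u` against `v̂` — has the same sum: modewise `𝓕(c₁ⱼu) = 𝓕((c₁ⱼ − c₂ⱼ)u) + 𝓕(c₂ⱼu)`
and the flux of `c₂` on `u` against `c₂` on `v` sums to zero (`Torus.hasSum_re_fourierFlux`).
[cite: KuksinShirikyan2012, Prop. 2.1.7 (2.11)] -/
private theorem hasSum_cross_split₁₂ [DecidableEq d] {𝔸₁ 𝔸₂ : Visc4 d}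
    {c₁ c₂ u v : UnitAddTorus d → EuclideanSpace ℝ d} {M : ℝ} {g : ℝ} (hM : 0 ≤ M)
    (hc₂ : AEStronglyMeasurable c₂ volume) (hc₂M : ∀ᵐ x ∂volume, ‖c₂ x‖ ≤ M)
    (hc₂div : FunctionSpaces.Torus.IsWeaklyDivFree c₂) (hu : MemLp u 2 volume) (hv : MemLp v 2 volume)
    (hu1 : FunctionSpaces.Torus.eGradNormSq u ≠ ⊤) (hv1 : FunctionSpaces.Torus.eGradNormSq v ≠ ⊤)
    (hc₁u : ∀ j, Integrable (fun x => c₁ x j • u x) volume)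
    (h : HasSum (fun k : d → ℤ =>
      ((-(4 * Real.pi ^ 2 : ℝ) : ℂ) *
          ⟪mFourierCoeff (FunctionSpaces.EuclideanSpace.complexify ∘ u) k,
            symbT 𝔸₁ k (mFourierCoeff (FunctionSpaces.EuclideanSpace.complexify ∘ v) k)
              - symbT 𝔸₂ k (mFourierCoeff (FunctionSpaces.EuclideanSpace.complexify ∘ v) k)⟫_ℂ +
        ∑ j, (2 * Real.pi * I * (k j)) *
          (⟪mFourierCoeff (FunctionSpaces.EuclideanSpace.complexify ∘ fun x => c₁ x j • u x) k,
              mFourierCoeff (FunctionSpaces.EuclideanSpace.complexify ∘ v) k⟫_ℂ -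
            ⟪mFourierCoeff (FunctionSpaces.EuclideanSpace.complexify ∘ u) k,
              mFourierCoeff (FunctionSpaces.EuclideanSpace.complexify ∘ fun x => c₂ x j • v x) k⟫_ℂ)).re) g) :
    HasSum (fun k : d → ℤ =>
      ((-(4 * Real.pi ^ 2 : ℝ) : ℂ) *
          ⟪mFourierCoeff (FunctionSpaces.EuclideanSpace.complexify ∘ u) k,
            symbT 𝔸₁ k (mFourierCoeff (FunctionSpaces.EuclideanSpace.complexify ∘ v) k)
              - symbT 𝔸₂ k (mFourierCoeff (FunctionSpaces.EuclideanSpace.complexify ∘ v) k)⟫_ℂ +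
        ∑ j, (2 * Real.pi * I * (k j)) *
          ⟪mFourierCoeff (FunctionSpaces.EuclideanSpace.complexify ∘ fun x => (c₁ x j - c₂ x j) • u x) k,
              mFourierCoeff (FunctionSpaces.EuclideanSpace.complexify ∘ v) k⟫_ℂ).re) g := by
  have hc₂u : ∀ j, Integrable (fun x => c₂ x j • u x) volume := fun j =>
    (memLp_two_smul_apply_ae₁₂ hc₂ hc₂M hu j).integrable one_le_two
  have hanti := hasSum_re_fourierFlux_ae₁₂ hM hc₂ hc₂M hc₂div hu hv (summable_freqNormSq_mul_sq₁₂ u hu1).1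
    (summable_freqNormSq_mul_sq₁₂ v hv1).1
  have hsub := h.sub hanti
  rw [sub_zero] at hsub
  -- modewise: `𝓕((c₁ⱼ − c₂ⱼ) u) = 𝓕(c₁ⱼ u) − 𝓕(c₂ⱼ u)`
  have e : ∀ j k, mFourierCoeff (FunctionSpaces.EuclideanSpace.complexify ∘ fun x => (c₁ x j - c₂ x j) • u x) k =
      mFourierCoeff (FunctionSpaces.EuclideanSpace.complexify ∘ fun x => c₁ x j • u x) k -
        mFourierCoeff (FunctionSpaces.EuclideanSpace.complexify ∘ fun x => c₂ x j • u x) k := by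
    intro j k
    have hi₁ : Integrable (FunctionSpaces.EuclideanSpace.complexify ∘ fun x => c₁ x j • u x) volume :=
      FunctionSpaces.EuclideanSpace.complexify.toContinuousLinearMap.integrable_comp (hc₁u j)
    have hi₂ : Integrable (FunctionSpaces.EuclideanSpace.complexify ∘ fun x => c₂ x j • u x) volume :=
      FunctionSpaces.EuclideanSpace.complexify.toContinuousLinearMap.integrable_comp (hc₂u j)
    rw [← FunctionSpaces.Torus.mFourierCoeff_sub hi₁ hi₂]
    congr 1
    funext x
    simp [sub_smul]
  refine hsub.congr_fun fun k => ?_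
  simp only [e, inner_sub_left, mul_sub, Complex.sub_re, Complex.add_re, Complex.re_sum, Finset.sum_sub_distrib]
  ring

end CrossSlice

/-! ## The two-problem duality -/

namespace IsWeakTensorPassiveVectorOn

variable {A T t₀ : ℝ} {𝔸 𝔸₁ 𝔸₂ : Visc4 d} {b w b₁ b₂ u ψ : ℝ → UnitAddTorus d → EuclideanSpace ℝ d}
  {w₀ u₀ φ : UnitAddTorus d → EuclideanSpace ℝ d}

/-- Time-measurability of the dissipation density `τ ↦ ‖∇w(τ)‖²` of a weak solution (Galerkin
coefficients are measurable in time). [cite: Temam1984, Ch. III §1 Lemma 1.2] -/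
private theorem aemeasurable_eGradNormSq₁₂ (h : IsWeakTensorPassiveVectorOn A T 𝔸 b w₀ w) :
    AEMeasurable (fun τ => FunctionSpaces.Torus.eGradNormSq (w τ)) (volume.restrict (Ioo 0 T)) :=
  aemeasurable_eGradNormSq_of_coeff fun k =>
    aestronglyMeasurable_mFourierCoeff_complexify_slice h.aestronglyMeasurable_uncurry k

/-- **A.e. time-slice facts for the two problems** (packaging of the class API): essential bounds
`M₁, M₂` of the carriers; time-integrability on `(0,t₀)` of the two dissipation densities
`‖∇u(σ)‖²`, `‖∇ψ(t₀−σ)‖²` (finite dissipations, `eVectorDissipation_lt_top`); and for a.e. `σ ∈ (0,t₀)`: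
`u(σ), ψ(t₀−σ) ∈ L²` with the energy bounds, measurable a.e.-bounded carrier slices `b₁(σ)`, `b₂(σ)`,
integrable products `b₁ⱼ(σ)u(σ)`, `b₂(σ)` weakly divergence free (the carrier of the adjoint problem
reflected in time), finite `‖∇u(σ)‖²`, `‖∇ψ(t₀−σ)‖²`. [cite: Temam1984, Ch. III §1 Lemma 1.2] -/
private theorem ae_slice₁₂ (hu : IsWeakTensorPassiveVectorOn 0 T 𝔸₁ b₁ u₀ u) (ht₀T : t₀ ≤ T)
    (hψ : IsWeakTensorPassiveVectorOn 0 t₀ (majorTranspose 𝔸₂) (fun r => -b₂ (t₀ - r)) φ ψ)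
    {lo hi : ℝ} (h𝔸₁ : NearIso 𝔸₁ lo hi) (h𝔸₂ : NearIso 𝔸₂ lo hi) (hlo : 0 < lo)
    (hu₀ : MemLp u₀ 2 volume) (hdivu₀ : FunctionSpaces.Torus.IsWeaklyDivFree u₀)
    (hφ : MemLp φ 2 volume) (hdivφ : FunctionSpaces.Torus.IsWeaklyDivFree φ)
    (hb₁ : MemLp (FunctionSpaces.Torus.stLift b₁) ∞ (volume.restrict (Ioo 0 T ×ˢ univ)))
    (hb₂ : MemLp (FunctionSpaces.Torus.stLift b₂) ∞ (volume.restrict (Ioo 0 T ×ˢ univ))) :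
    ∃ M₁ M₂ : ℝ, 0 ≤ M₁ ∧ 0 ≤ M₂ ∧
      IntegrableOn (fun σ => (FunctionSpaces.Torus.eGradNormSq (u σ)).toReal) (Ioo 0 t₀) volume ∧
      IntegrableOn (fun σ => (FunctionSpaces.Torus.eGradNormSq (ψ (t₀ - σ))).toReal) (Ioo 0 t₀) volume ∧
      ∀ᵐ σ ∂(volume.restrict (Ioo 0 t₀)),
        (MemLp (u σ) 2 volume ∧ AEStronglyMeasurable (b₁ σ) volume ∧ (∀ᵐ x ∂volume, ‖b₁ σ x‖ ≤ M₁) ∧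
          (∀ j, Integrable (fun x => b₁ σ x j • u σ x) volume) ∧
          FunctionSpaces.Torus.eGradNormSq (u σ) ≠ ⊤ ∧ ∫ x, ‖u σ x‖ ^ 2 ≤ ∫ x, ‖u₀ x‖ ^ 2) ∧
        (MemLp (ψ (t₀ - σ)) 2 volume ∧ AEStronglyMeasurable (b₂ σ) volume ∧ (∀ᵐ x ∂volume, ‖b₂ σ x‖ ≤ M₂) ∧
          FunctionSpaces.Torus.IsWeaklyDivFree (b₂ σ) ∧
          FunctionSpaces.Torus.eGradNormSq (ψ (t₀ - σ)) ≠ ⊤ ∧ ∫ x, ‖ψ (t₀ - σ) x‖ ^ 2 ≤ ∫ x, ‖φ x‖ ^ 2) := by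
  have hb₂' : MemLp (FunctionSpaces.Torus.stLift (fun r => -b₂ (t₀ - r))) ∞ (volume.restrict (Ioo 0 t₀ ×ˢ univ)) :=
    memLp_top_stLift_reversed hb₂ ht₀T
  have hsubT : Ioo 0 t₀ ⊆ Ioo 0 T := Ioo_subset_Ioo le_rfl ht₀T
  have h𝔸₂' : NearIso (majorTranspose 𝔸₂) lo hi := (nearIso_majorTranspose_iff 𝔸₂ lo hi).2 h𝔸₂
  obtain ⟨M₁, hM₁, hbM₁⟩ := ae_ae_norm_le_of_memLp_top_stLift hb₁
  obtain ⟨M₂, hM₂, hbM₂⟩ := ae_ae_norm_le_of_memLp_top_stLift hb₂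
  -- finite dissipations and measurable dissipation densities
  have hfin_u : ∫⁻ s in Ioo 0 T, FunctionSpaces.Torus.eGradNormSq (u s) < ⊤ := by
    have hDT := hu.eVectorDissipation_lt_top h𝔸₁ hlo hu₀ hdivu₀ hb₁
    unfold eVectorDissipation at hDT
    rcases ENNReal.mul_lt_top_iff.1 hDT with h1 | h1 | h1
    · exact h1.2
    · exact absurd (ENNReal.ofReal_eq_zero.1 h1) (not_le.2 hlo)
    · rw [h1]; exact ENNReal.zero_lt_top
  have hfin_ψ : ∫⁻ r in Ioo 0 t₀, FunctionSpaces.Torus.eGradNormSq (ψ r) < ⊤ := by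
    have hDT := hψ.eVectorDissipation_lt_top h𝔸₂' hlo hφ hdivφ hb₂'
    unfold eVectorDissipation at hDT
    rcases ENNReal.mul_lt_top_iff.1 hDT with h1 | h1 | h1
    · exact h1.2
    · exact absurd (ENNReal.ofReal_eq_zero.1 h1) (not_le.2 hlo)
    · rw [h1]; exact ENNReal.zero_lt_top
  have hmu : AEMeasurable (fun s => FunctionSpaces.Torus.eGradNormSq (u s)) (volume.restrict (Ioo 0 T)) :=
    aemeasurable_eGradNormSq₁₂ hu
  have hmψ : AEMeasurable (fun r => FunctionSpaces.Torus.eGradNormSq (ψ r)) (volume.restrict (Ioo 0 t₀)) :=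
    aemeasurable_eGradNormSq₁₂ hψ
  have i1T : IntegrableOn (fun σ => (FunctionSpaces.Torus.eGradNormSq (u σ)).toReal) (Ioo 0 T) volume :=
    integrable_toReal_of_lintegral_ne_top hmu hfin_u.ne
  have i2 : IntegrableOn (fun σ => (FunctionSpaces.Torus.eGradNormSq (ψ (t₀ - σ))).toReal) (Ioo 0 t₀) volume :=
    integrableOn_comp_sub_left₁₂ (integrable_toReal_of_lintegral_ne_top hmψ hfin_ψ.ne)
  refine ⟨M₁, M₂, hM₁, hM₂, i1T.mono_set hsubT, i2, ?_⟩
  have h3u : ∀ᵐ σ ∂(volume.restrict (Ioo 0 t₀)),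
      MemLp (u σ) 2 volume ∧ AEStronglyMeasurable (b₁ σ) volume ∧ (∀ᵐ x ∂volume, ‖b₁ σ x‖ ≤ M₁) ∧
        (∀ j, Integrable (fun x => b₁ σ x j • u σ x) volume) ∧
        FunctionSpaces.Torus.eGradNormSq (u σ) ≠ ⊤ ∧ ∫ x, ‖u σ x‖ ^ 2 ≤ ∫ x, ‖u₀ x‖ ^ 2 := by
    have h := ae_restrict_of_ae_restrict_of_subset hsubT
      (hu.ae_memLp_two.and (hu.ae_aestronglyMeasurable_slice.and (hbM₁.and (hu.ae_integrable_slice.and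
        ((ae_lt_top' hmu hfin_u.ne).and (hu.ae_integral_norm_sq_le h𝔸₁ hlo hu₀ hdivu₀ hb₁))))))
    refine h.mono fun σ hσ => ?_
    obtain ⟨h2, hsm, hb1, hsl, htop, hE⟩ := hσ
    exact ⟨h2, hsm.2, hb1, hsl.2.1, htop.ne, hE⟩
  have h3ψ : ∀ᵐ σ ∂(volume.restrict (Ioo 0 t₀)),
      MemLp (ψ (t₀ - σ)) 2 volume ∧ AEStronglyMeasurable (b₂ σ) volume ∧ (∀ᵐ x ∂volume, ‖b₂ σ x‖ ≤ M₂) ∧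
        FunctionSpaces.Torus.IsWeaklyDivFree (b₂ σ) ∧
        FunctionSpaces.Torus.eGradNormSq (ψ (t₀ - σ)) ≠ ⊤ ∧ ∫ x, ‖ψ (t₀ - σ) x‖ ^ 2 ≤ ∫ x, ‖φ x‖ ^ 2 := by
    have h := ae_restrict_Ioo_comp_sub_left₁₂ (hψ.ae_memLp_two.and (hψ.ae_aestronglyMeasurable_slice.and
      (hψ.ae_isWeaklyDivFree_carrier.and
        ((ae_lt_top' hmψ hfin_ψ.ne).and (hψ.ae_integral_norm_sq_le h𝔸₂' hlo hφ hdivφ hb₂')))))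
    have hb2 := ae_restrict_of_ae_restrict_of_subset hsubT hbM₂
    filter_upwards [h, hb2] with σ hσ hb2σ
    obtain ⟨h2, hsm, hdiv, htop, hE⟩ := hσ
    refine ⟨h2, ?_, hb2σ, ?_, htop.ne, hE⟩
    · have h1 := hsm.2.neg
      simpa [sub_sub_cancel] using h1
    · refine isWeaklyDivFree_of_neg₁₂ ?_
      simpa [sub_sub_cancel] using hdiv
  filter_upwards [h3u, h3ψ] with σ h1 h2
  exact ⟨h1, h2⟩

/-- **Two-problem duality with cross terms (a.e. form).** Let `u` be a weak tensor-viscosity passive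
solenoidal vector on `(0,T)` with tensor `𝔸₁`, carrier `b₁`, datum `u₀`, and, for `0 < t₀ ≤ T`, let `ψ`
be a weak solution on `(0,t₀)` of the same class with tensor `𝔸₂ᵀ`, carrier `r ↦ −b₂(t₀ − r)` and datum
`φ` (the adjoint of problem 2, written forward in `r = t₀ − s`). Assume `NearIso 𝔸ᵢ lo hi`, `0 < lo`,
both carriers essentially bounded and both data in `L²` and weakly divergence free. Then there are an
integrable function `G` on `(0,t₀)` — at a.e. time `σ` the sum of the (absolutely convergent) mode
family `Re( −4π² ⟪û(σ)(k), (T_{𝔸₁}(k) − T_{𝔸₂}(k)) ψ̂(t₀−σ)(k)⟫ + Σⱼ 2πikⱼ (⟪𝓕(b₁ⱼ(σ) u(σ))(k), ψ̂(t₀−σ)(k)⟫ − ⟪û(σ)(k), 𝓕(b₂ⱼ(σ) ψ(t₀−σ))(k)⟫) )`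
— and a constant `c` with `∫⟪u(s), ψ(t₀ − s)⟫ = c + ∫_{(0,s]} G` for a.e. `s ∈ (0,t₀)`.
Temam's Lemma III.1.2 (polarised product rule for the Galerkin truncations) for TWO problems: as in
`exists_ae_integral_inner_reversed_eq_const`, but the viscous terms no longer cancel (they leave the
symbol of `𝔸₁ − 𝔸₂`) and the two transport terms carry different carriers; the finite mode sums are
dominated uniformly in `N` by an integrable function of time (`summable_re_cross_and_abs_sum_le`, finite
dissipations, energy bounds), so dominated convergence passes to the limit in the time integral, and
Parseval identifies the truncated pairings' limit. [cite: Temam1984, Ch. III §1 Lemma 1.2]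
[cite: Frisch1995Turbulence, §9.6.3 eq. (9.57) p. 233] -/
theorem exists_integrableOn_hasSum_cross (hu : IsWeakTensorPassiveVectorOn 0 T 𝔸₁ b₁ u₀ u)
    (ht₀ : 0 < t₀) (ht₀T : t₀ ≤ T)
    (hψ : IsWeakTensorPassiveVectorOn 0 t₀ (majorTranspose 𝔸₂) (fun r => -b₂ (t₀ - r)) φ ψ)
    {lo hi : ℝ} (h𝔸₁ : NearIso 𝔸₁ lo hi) (h𝔸₂ : NearIso 𝔸₂ lo hi) (hlo : 0 < lo)
    (hu₀ : MemLp u₀ 2 volume) (hdivu₀ : FunctionSpaces.Torus.IsWeaklyDivFree u₀)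
    (hφ : MemLp φ 2 volume) (hdivφ : FunctionSpaces.Torus.IsWeaklyDivFree φ)
    (hb₁ : MemLp (FunctionSpaces.Torus.stLift b₁) ∞ (volume.restrict (Ioo 0 T ×ˢ univ)))
    (hb₂ : MemLp (FunctionSpaces.Torus.stLift b₂) ∞ (volume.restrict (Ioo 0 T ×ˢ univ))) :
    ∃ G : ℝ → ℝ, IntegrableOn G (Ioo 0 t₀) volume ∧
      (∀ᵐ σ ∂(volume.restrict (Ioo 0 t₀)), HasSum (fun k : d → ℤ =>
        ((-(4 * Real.pi ^ 2 : ℝ) : ℂ) *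
            ⟪mFourierCoeff (FunctionSpaces.EuclideanSpace.complexify ∘ u σ) k,
              symbT 𝔸₁ k (mFourierCoeff (FunctionSpaces.EuclideanSpace.complexify ∘ ψ (t₀ - σ)) k)
                - symbT 𝔸₂ k (mFourierCoeff (FunctionSpaces.EuclideanSpace.complexify ∘ ψ (t₀ - σ)) k)⟫_ℂ +
          ∑ j, (2 * Real.pi * I * (k j)) *
            (⟪mFourierCoeff (FunctionSpaces.EuclideanSpace.complexify ∘ fun x => b₁ σ x j • u σ x) k,
                mFourierCoeff (FunctionSpaces.EuclideanSpace.complexify ∘ ψ (t₀ - σ)) k⟫_ℂ -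
              ⟪mFourierCoeff (FunctionSpaces.EuclideanSpace.complexify ∘ u σ) k,
                mFourierCoeff (FunctionSpaces.EuclideanSpace.complexify ∘ fun x => b₂ σ x j • ψ (t₀ - σ) x) k⟫_ℂ)).re)
        (G σ)) ∧
      ∃ c : ℝ, ∀ᵐ s ∂(volume.restrict (Ioo 0 t₀)),
        ∫ x, ⟪u s x, ψ (t₀ - s) x⟫_ℝ = c + ∫ σ in Ioc 0 s, G σ := by
  classical
  have hu₀i : Integrable u₀ volume := hu₀.integrable one_le_two
  have hφi : Integrable φ volume := hφ.integrable one_le_two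
  have hsubT : Ioo 0 t₀ ⊆ Ioo 0 T := Ioo_subset_Ioo le_rfl ht₀T
  -- ### notation: modes, mode right-hand sides
  set Xu : (d → ℤ) → ℝ → EuclideanSpace ℂ d := fun k s =>
    mFourierCoeff (FunctionSpaces.EuclideanSpace.complexify ∘ u s) k with hXu
  set Xψ : (d → ℤ) → ℝ → EuclideanSpace ℂ d := fun k r =>
    mFourierCoeff (FunctionSpaces.EuclideanSpace.complexify ∘ ψ r) k with hXψ
  set X₀ : (d → ℤ) → EuclideanSpace ℂ d := fun k =>
    mFourierCoeff (FunctionSpaces.EuclideanSpace.complexify ∘ u₀) k with hX₀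
  set Φ₀ : (d → ℤ) → EuclideanSpace ℂ d := fun k =>
    mFourierCoeff (FunctionSpaces.EuclideanSpace.complexify ∘ φ) k with hΦ₀
  set Hu : (d → ℤ) → EuclideanSpace ℂ d → ℝ → ℂ := fun k z σ =>
    (-(4 * Real.pi ^ 2 : ℝ) : ℂ) * ⟪Xu k σ, symbT 𝔸₁ k z⟫_ℂ +
      ((∑ j, (2 * Real.pi * I * (k j)) *
          ⟪mFourierCoeff (FunctionSpaces.EuclideanSpace.complexify ∘ fun x => b₁ σ x j • u σ x) k, z⟫_ℂ) +
        ((0 : ℝ) : ℂ) * ∑ j, (2 * Real.pi * I * (k j)) *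
          ⟪mFourierCoeff (FunctionSpaces.EuclideanSpace.complexify ∘ fun x => u σ x j • b₁ σ x) k, z⟫_ℂ) with hHu
  set Hψ : (d → ℤ) → EuclideanSpace ℂ d → ℝ → ℂ := fun k z r =>
    (-(4 * Real.pi ^ 2 : ℝ) : ℂ) * ⟪Xψ k r, symbT (majorTranspose 𝔸₂) k z⟫_ℂ +
      ((∑ j, (2 * Real.pi * I * (k j)) *
          ⟪mFourierCoeff (FunctionSpaces.EuclideanSpace.complexify ∘ fun x => (-b₂ (t₀ - r)) x j • ψ r x) k, z⟫_ℂ) +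
        ((0 : ℝ) : ℂ) * ∑ j, (2 * Real.pi * I * (k j)) *
          ⟪mFourierCoeff (FunctionSpaces.EuclideanSpace.complexify ∘ fun x => ψ r x j • (-b₂ (t₀ - r)) x) k, z⟫_ℂ) with hHψ
  have hHui : ∀ k z, IntegrableOn (Hu k z) (Ioo 0 T) volume := fun k z => hu.integrableOn_modeRHS k z
  have hHψi : ∀ k z, IntegrableOn (Hψ k z) (Ioo 0 t₀) volume := fun k z => hψ.integrableOn_modeRHS k z
  -- ### orthonormal bases of the transversal subspaces
  set S : (d → ℤ) → Submodule ℂ (EuclideanSpace ℂ d) := fun k =>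
    (ℂ ∙ (WithLp.toLp 2 (fun j => ((k j : ℤ) : ℂ)) : EuclideanSpace ℂ d))ᗮ with hS
  set e : (k : d → ℤ) → Fin (Module.finrank ℂ (S k)) → EuclideanSpace ℂ d :=
    fun k i => ((stdOrthonormalBasis ℂ (S k)) i : EuclideanSpace ℂ d) with he
  have he_tr : ∀ k i, ∑ j, (k j : ℂ) * e k i j = 0 := fun k i =>
    (mem_orthogonal_waveVec_iff k _).1 ((stdOrthonormalBasis ℂ (S k)) i).2
  -- ### the absolutely continuous representatives of the tested modes
  set α : (k : d → ℤ) → Fin (Module.finrank ℂ (S k)) → ℝ → ℂ := fun k i s =>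
    ⟪X₀ k, e k i⟫_ℂ + ∫ σ in Ioc 0 s, Hu k (e k i) σ with hα
  set β : (k : d → ℤ) → Fin (Module.finrank ℂ (S k)) → ℝ → ℂ := fun k i r =>
    ⟪Φ₀ k, e k i⟫_ℂ + ∫ ρ in Ioc 0 r, Hψ k (e k i) ρ with hβ
  set p : (d → ℤ) → ℝ → ℂ := fun k s => ∑ i, α k i s * conj (β k i (t₀ - s)) with hp
  set q : (d → ℤ) → ℝ → ℂ := fun k σ =>
    ∑ i, (Hu k (e k i) σ * conj (β k i (t₀ - σ)) + α k i σ * -conj (Hψ k (e k i) (t₀ - σ))) with hq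
  -- ### Claim A: the truncated pairing representatives are primitives
  have hA : ∀ k, IntegrableOn (q k) (Ioc 0 t₀) volume ∧
      ∀ s₁ s₂, 0 < s₁ → s₁ ≤ s₂ → s₂ ≤ t₀ → p k s₂ - p k s₁ = ∫ σ in Ioc s₁ s₂, q k σ := by
    intro k
    -- per basis vector
    have hi : ∀ i, ∀ t ∈ Ioc 0 t₀,
        IntegrableOn (fun σ => Hu k (e k i) σ * conj (β k i (t₀ - σ)) + α k i σ * -conj (Hψ k (e k i) (t₀ - σ))) (Ioc 0 t) volume ∧
        α k i t * conj (β k i (t₀ - t)) = ⟪X₀ k, e k i⟫_ℂ * conj (β k i t₀) +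
          ∫ σ in Ioc 0 t, (Hu k (e k i) σ * conj (β k i (t₀ - σ)) + α k i σ * -conj (Hψ k (e k i) (t₀ - σ))) := by
      intro i t ht
      have hφI : IntegrableOn (Hu k (e k i)) (Ioo 0 t₀) volume := (hHui k (e k i)).mono_set hsubT
      have hγ0 : IntegrableOn (fun σ => Hψ k (e k i) (t₀ - σ)) (Ioo 0 t₀) volume :=
        integrableOn_comp_sub_left₁₂ (hHψi k (e k i))
      have hγI : IntegrableOn (fun σ => -conj (Hψ k (e k i) (t₀ - σ))) (Ioo 0 t₀) volume := by
        have h1 : IntegrableOn (fun σ => Complex.conjCLE (Hψ k (e k i) (t₀ - σ))) (Ioo 0 t₀) volume :=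
          Complex.conjCLE.toContinuousLinearMap.integrable_comp hγ0
        simp only [Complex.conjCLE_apply] at h1
        exact h1.neg
      refine mul_eq_add_setIntegral_of_eq_add_setIntegral_complex₁₂ (T := t₀) (F := α k i)
        (G := fun s => conj (β k i (t₀ - s))) hφI hγI (fun t _ => rfl) (fun t' ht' => ?_) ht
      -- the reflected primitive
      show conj (β k i (t₀ - t')) = conj (β k i t₀) + ∫ σ in Ioc 0 t', -conj (Hψ k (e k i) (t₀ - σ))
      have hrefl := setIntegral_Ioc_sub_eq₁₂ (hHψi k (e k i)) (s := t') ⟨ht'.1.le, ht'.2⟩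
      simp only [hβ]
      rw [hrefl]
      simp only [map_add, map_neg, ← integral_conj]
      ring
    refine ⟨?_, fun s₁ s₂ hs₁ hs₁₂ hs₂ => ?_⟩
    · exact integrable_finsetSum _ fun i _ => (hi i t₀ ⟨ht₀, le_rfl⟩).1
    · have hs₂I : s₂ ∈ Ioc 0 t₀ := ⟨hs₁.trans_le hs₁₂, hs₂⟩
      have hs₁I : s₁ ∈ Ioc 0 t₀ := ⟨hs₁, hs₁₂.trans hs₂⟩
      have hdiff : ∀ i, α k i s₂ * conj (β k i (t₀ - s₂)) - α k i s₁ * conj (β k i (t₀ - s₁)) =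
          ∫ σ in Ioc s₁ s₂, (Hu k (e k i) σ * conj (β k i (t₀ - σ)) + α k i σ * -conj (Hψ k (e k i) (t₀ - σ))) := by
        intro i
        rw [(hi i s₂ hs₂I).2, (hi i s₁ hs₁I).2, add_sub_add_left_eq_sub,
          setIntegral_Ioc_sub_setIntegral_Ioc₁₂ (hi i s₂ hs₂I).1 hs₁.le hs₁₂]
      rw [hp, hq]
      simp only
      rw [← Finset.sum_sub_distrib, integral_finsetSum _ fun i _ => ?_]
      · exact Finset.sum_congr rfl fun i _ => hdiff i
      · exact ((hi i t₀ ⟨ht₀, le_rfl⟩).1).mono_set (Ioc_subset_Ioc hs₁.le hs₂)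
  -- ### local algebra in the bases `e k`
  have honb : ∀ k (X : EuclideanSpace ℂ d), X ∈ S k → ∑ i, conj ⟪X, e k i⟫_ℂ • e k i = X :=
    fun k X hX => sum_conj_inner_smul_onb₁₂ (stdOrthonormalBasis ℂ (S k)) hX
  have hpair : ∀ k (X Y : EuclideanSpace ℂ d), Y ∈ S k → ∑ i, ⟪X, e k i⟫_ℂ * conj ⟪Y, e k i⟫_ℂ = ⟪X, Y⟫_ℂ :=
    fun k X Y hY => sum_inner_mul_conj_inner_onb₁₂ (stdOrthonormalBasis ℂ (S k)) X hY
  have hHu_lin : ∀ k σ (μ : Fin (Module.finrank ℂ (S k)) → ℂ),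
      Hu k (∑ i, μ i • e k i) σ = ∑ i, μ i * Hu k (e k i) σ := fun k σ μ =>
    modeRHS_sum_smul₁₂ Finset.univ 𝔸₁ k 0 (Xu k σ)
      (fun j => mFourierCoeff (FunctionSpaces.EuclideanSpace.complexify ∘ fun x => b₁ σ x j • u σ x) k)
      (fun j => mFourierCoeff (FunctionSpaces.EuclideanSpace.complexify ∘ fun x => u σ x j • b₁ σ x) k) μ (e k)
  have hHψ_lin : ∀ k r (μ : Fin (Module.finrank ℂ (S k)) → ℂ),
      Hψ k (∑ i, μ i • e k i) r = ∑ i, μ i * Hψ k (e k i) r := fun k r μ =>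
    modeRHS_sum_smul₁₂ Finset.univ (majorTranspose 𝔸₂) k 0 (Xψ k r)
      (fun j => mFourierCoeff (FunctionSpaces.EuclideanSpace.complexify ∘ fun x => (-b₂ (t₀ - r)) x j • ψ r x) k)
      (fun j => mFourierCoeff (FunctionSpaces.EuclideanSpace.complexify ∘ fun x => ψ r x j • (-b₂ (t₀ - r)) x) k) μ (e k)
  -- ### a.e. facts in `σ ∈ (0,t₀)`: the representatives are the tested modes, which are transversal
  have hB1u : ∀ᵐ σ ∂(volume.restrict (Ioo 0 t₀)), ∀ k, ∀ i, α k i σ = ⟪Xu k σ, e k i⟫_ℂ := by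
    have h : ∀ᵐ σ ∂(volume.restrict (Ioo 0 T)), ∀ k, ∀ i, ⟪Xu k σ, e k i⟫_ℂ = α k i σ :=
      ae_all_iff.2 fun k => ae_all_iff.2 fun i => hu.ae_inner_mFourierCoeff_eq hu₀i k (he_tr k i)
    exact (ae_restrict_of_ae_restrict_of_subset hsubT h).mono fun σ hσ k i => (hσ k i).symm
  have hB2u : ∀ᵐ σ ∂(volume.restrict (Ioo 0 t₀)), ∀ k, Xu k σ ∈ S k := by
    have h : ∀ᵐ σ ∂(volume.restrict (Ioo 0 T)), ∀ k : d → ℤ, ∑ j, (k j : ℂ) * Xu k σ j = 0 :=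
      ae_all_iff.2 fun k => hu.ae_sum_mul_mFourierCoeff_eq_zero k
    exact (ae_restrict_of_ae_restrict_of_subset hsubT h).mono fun σ hσ k =>
      (mem_orthogonal_waveVec_iff k _).2 (hσ k)
  have hB1ψ : ∀ᵐ σ ∂(volume.restrict (Ioo 0 t₀)), ∀ k, ∀ i, β k i (t₀ - σ) = ⟪Xψ k (t₀ - σ), e k i⟫_ℂ := by
    have h : ∀ᵐ r ∂(volume.restrict (Ioo 0 t₀)), ∀ k, ∀ i, ⟪Xψ k r, e k i⟫_ℂ = β k i r :=
      ae_all_iff.2 fun k => ae_all_iff.2 fun i => hψ.ae_inner_mFourierCoeff_eq hφi k (he_tr k i)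
    exact (ae_restrict_Ioo_comp_sub_left₁₂ h).mono fun σ hσ k i => (hσ k i).symm
  have hB2ψ : ∀ᵐ σ ∂(volume.restrict (Ioo 0 t₀)), ∀ k, Xψ k (t₀ - σ) ∈ S k := by
    have h : ∀ᵐ r ∂(volume.restrict (Ioo 0 t₀)), ∀ k : d → ℤ, ∑ j, (k j : ℂ) * Xψ k r j = 0 :=
      ae_all_iff.2 fun k => hψ.ae_sum_mul_mFourierCoeff_eq_zero k
    exact (ae_restrict_Ioo_comp_sub_left₁₂ h).mono fun σ hσ k => (mem_orthogonal_waveVec_iff k _).2 (hσ k)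
  -- ### Claim B: for a.e. `σ`, `q k σ = H^u_σ(ψ̂(t₀−σ)(k)) − conj H^ψ_{t₀−σ}(û(σ)(k))`
  have hB : ∀ᵐ σ ∂(volume.restrict (Ioo 0 t₀)), ∀ k,
      q k σ = Hu k (Xψ k (t₀ - σ)) σ - conj (Hψ k (Xu k σ) (t₀ - σ)) := by
    filter_upwards [hB1u, hB2u, hB1ψ, hB2ψ] with σ h1u h2u h1ψ h2ψ k
    have e1 : ∑ i, Hu k (e k i) σ * conj (β k i (t₀ - σ)) = Hu k (Xψ k (t₀ - σ)) σ := by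
      calc ∑ i, Hu k (e k i) σ * conj (β k i (t₀ - σ))
          = ∑ i, conj ⟪Xψ k (t₀ - σ), e k i⟫_ℂ * Hu k (e k i) σ :=
            Finset.sum_congr rfl fun i _ => by rw [h1ψ k i, mul_comm]
        _ = Hu k (∑ i, conj ⟪Xψ k (t₀ - σ), e k i⟫_ℂ • e k i) σ := (hHu_lin k σ _).symm
        _ = Hu k (Xψ k (t₀ - σ)) σ := by rw [honb k _ (h2ψ k)]
    have e2 : ∑ i, α k i σ * -conj (Hψ k (e k i) (t₀ - σ)) = -conj (Hψ k (Xu k σ) (t₀ - σ)) := by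
      calc ∑ i, α k i σ * -conj (Hψ k (e k i) (t₀ - σ))
          = -conj (∑ i, conj ⟪Xu k σ, e k i⟫_ℂ * Hψ k (e k i) (t₀ - σ)) := by
            rw [map_sum, ← Finset.sum_neg_distrib]
            refine Finset.sum_congr rfl fun i _ => ?_
            rw [h1u k i, map_mul, Complex.conj_conj]
            ring
        _ = -conj (Hψ k (∑ i, conj ⟪Xu k σ, e k i⟫_ℂ • e k i) (t₀ - σ)) := by rw [hHψ_lin k (t₀ - σ)]
        _ = -conj (Hψ k (Xu k σ) (t₀ - σ)) := by rw [honb k _ (h2u k)]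
    rw [hq]
    simp only
    rw [Finset.sum_add_distrib, e1, e2]
    ring
  -- ### slice facts for a.e. `σ ∈ (0,t₀)`
  obtain ⟨M₁, M₂, hM₁, hM₂, i1, i2, h3⟩ := ae_slice₁₂ hu ht₀T hψ h𝔸₁ h𝔸₂ hlo hu₀ hdivu₀ hφ hdivφ hb₁ hb₂
  -- ### Claim C': for a.e. `σ`, the real parts of `q k σ` are the cross terms
  set X : (d → ℤ) → ℝ → ℝ := fun k σ =>
    ((-(4 * Real.pi ^ 2 : ℝ) : ℂ) * ⟪Xu k σ, symbT 𝔸₁ k (Xψ k (t₀ - σ)) - symbT 𝔸₂ k (Xψ k (t₀ - σ))⟫_ℂ +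
      ∑ j, (2 * Real.pi * I * (k j)) *
        (⟪mFourierCoeff (FunctionSpaces.EuclideanSpace.complexify ∘ fun x => b₁ σ x j • u σ x) k, Xψ k (t₀ - σ)⟫_ℂ -
          ⟪Xu k σ, mFourierCoeff (FunctionSpaces.EuclideanSpace.complexify ∘ fun x => b₂ σ x j • ψ (t₀ - σ) x) k⟫_ℂ)).re
    with hXdef
  have hre : ∀ᵐ σ ∂(volume.restrict (Ioo 0 t₀)), ∀ k, (q k σ).re = X k σ := by
    filter_upwards [hB] with σ hBσ k
    have hadj : (⟪Xψ k (t₀ - σ), symbT (majorTranspose 𝔸₂) k (Xu k σ)⟫_ℂ).re =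
        (⟪Xu k σ, symbT 𝔸₂ k (Xψ k (t₀ - σ))⟫_ℂ).re := by
      rw [← inner_conj_symm (Xψ k (t₀ - σ)) (symbT (majorTranspose 𝔸₂) k (Xu k σ)), Complex.conj_re,
        inner_symbT_majorTranspose_left]
    have hF : ∀ j, mFourierCoeff (FunctionSpaces.EuclideanSpace.complexify ∘
        fun x => (-b₂ (t₀ - (t₀ - σ))) x j • ψ (t₀ - σ) x) k =
        -mFourierCoeff (FunctionSpaces.EuclideanSpace.complexify ∘ fun x => b₂ σ x j • ψ (t₀ - σ) x) k := by
      intro j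
      rw [← FunctionSpaces.Torus.mFourierCoeff_neg]
      congr 1
      funext x
      simp [sub_sub_cancel, neg_smul]
    have hflip : ∀ j, ((2 * Real.pi * I * (k j)) *
        ⟪mFourierCoeff (FunctionSpaces.EuclideanSpace.complexify ∘ fun x => b₂ σ x j • ψ (t₀ - σ) x) k, Xu k σ⟫_ℂ).re =
        -(((2 * Real.pi * I * (k j)) * ⟪Xu k σ,
          mFourierCoeff (FunctionSpaces.EuclideanSpace.complexify ∘ fun x => b₂ σ x j • ψ (t₀ - σ) x) k⟫_ℂ).re) := by
      intro j
      rw [← inner_conj_symm (Xu k σ), re_two_pi_I_mul_conj₁₂, neg_neg]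
    rw [hBσ k, hHu, hHψ]
    simp only [hF, inner_neg_left, mul_neg, neg_mul, Complex.sub_re, Complex.add_re, Complex.neg_re, Complex.conj_re,
      Complex.re_sum, Complex.re_ofReal_mul, Complex.ofReal_zero, zero_mul, add_zero, neg_neg,
      Finset.sum_neg_distrib, hflip, hadj]
    rw [hXdef]
    simp only [Complex.add_re, Complex.re_sum, neg_mul, Complex.neg_re, Complex.re_ofReal_mul, inner_sub_right,
      mul_sub, Complex.sub_re, Finset.sum_sub_distrib]
    ring
  -- ### Claim G: for a.e. `σ`, the cross family is summable and its partial sums are dominated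
  set E₀ : ℝ := ∫ x, ‖u₀ x‖ ^ 2 with hE₀
  set F₀ : ℝ := ∫ x, ‖φ x‖ ^ 2 with hF₀
  set Acst : ℝ := (∑ i, ∑ a, ∑ j, ∑ b, |𝔸₁ i a j b|) + (∑ i, ∑ a, ∑ j, ∑ b, |𝔸₂ i a j b|) + 1 with hAcst
  have hAcst0 : 0 ≤ Acst := by rw [hAcst]; positivity
  set Γ : ℝ → ℝ := fun σ => Acst * ((FunctionSpaces.Torus.eGradNormSq (u σ)).toReal +
      (FunctionSpaces.Torus.eGradNormSq (ψ (t₀ - σ))).toReal) +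
      Real.pi * Fintype.card d * (M₁ ^ 2 * E₀ + M₂ ^ 2 * F₀) with hΓ
  have hG : ∀ᵐ σ ∂(volume.restrict (Ioo 0 t₀)), Summable (fun k => X k σ) ∧
      ∀ N, |∑ k ∈ FunctionSpaces.Torus.freqBall N, X k σ| ≤ Γ σ := by
    filter_upwards [h3] with σ h3σ
    obtain ⟨⟨hu2, hb1m, hb1M, -, hutop, hEu⟩, ⟨hψ2, hb2m, hb2M, -, hψtop, hEψ⟩⟩ := h3σ
    obtain ⟨hs, hbd⟩ := summable_re_cross_and_abs_sum_le (𝔸₁ := 𝔸₁) (𝔸₂ := 𝔸₂)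
      hb1m hb1M hb2m hb2M hu2 hψ2 hutop hψtop
    refine ⟨hs, fun N => (hbd _).trans ?_⟩
    rw [hΓ]
    dsimp only
    have hc0 : 0 ≤ Real.pi * Fintype.card d := by positivity
    have h1 : M₁ ^ 2 * (∫ x, ‖u σ x‖ ^ 2) ≤ M₁ ^ 2 * E₀ := mul_le_mul_of_nonneg_left hEu (sq_nonneg _)
    have h2 : M₂ ^ 2 * (∫ x, ‖ψ (t₀ - σ) x‖ ^ 2) ≤ M₂ ^ 2 * F₀ := mul_le_mul_of_nonneg_left hEψ (sq_nonneg _)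
    have h3 := mul_le_mul_of_nonneg_left (add_le_add h1 h2) hc0
    linarith
  have hΓi : IntegrableOn Γ (Ioo 0 t₀) volume := by
    have i3 : IntegrableOn (fun _ : ℝ => Real.pi * Fintype.card d * (M₁ ^ 2 * E₀ + M₂ ^ 2 * F₀)) (Ioo 0 t₀) volume :=
      (continuous_const.integrableOn_Icc (a := (0 : ℝ)) (b := t₀)).mono_set Ioo_subset_Icc_self
    exact ((i1.add i2).const_mul Acst).add i3
  -- ### the truncated sums: integrable in time, convergent and dominated at a.e. time
  have hRqi : ∀ N, IntegrableOn (fun σ => ∑ k ∈ FunctionSpaces.Torus.freqBall N, (q k σ).re) (Ioo 0 t₀) volume :=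
    fun N => integrable_finsetSum _ fun k _ => ((hA k).1.mono_set Ioo_subset_Ioc_self).re
  set G : ℝ → ℝ := fun σ => ∑' k, X k σ with hGdef
  have hlimF : ∀ᵐ σ ∂(volume.restrict (Ioo 0 t₀)),
      Tendsto (fun N => ∑ k ∈ FunctionSpaces.Torus.freqBall N, (q k σ).re) atTop (𝓝 (G σ)) ∧
        ∀ N, |∑ k ∈ FunctionSpaces.Torus.freqBall N, (q k σ).re| ≤ Γ σ := by
    filter_upwards [hre, hG] with σ hreσ hGσ
    have e : ∀ N, ∑ k ∈ FunctionSpaces.Torus.freqBall N, (q k σ).re = ∑ k ∈ FunctionSpaces.Torus.freqBall N, X k σ :=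
      fun N => Finset.sum_congr rfl fun k _ => hreσ k
    refine ⟨?_, fun N => by rw [e N]; exact hGσ.2 N⟩
    have h := hGσ.1.hasSum.comp FunctionSpaces.Torus.tendsto_freqBall_atTop
    refine h.congr fun N => ?_
    rw [Function.comp_apply, e N]
  have hGm : AEStronglyMeasurable G (volume.restrict (Ioo 0 t₀)) :=
    aestronglyMeasurable_of_tendsto_ae atTop (fun N => (hRqi N).aestronglyMeasurable) (hlimF.mono fun σ hσ => hσ.1)
  have hGΓ : ∀ᵐ σ ∂(volume.restrict (Ioo 0 t₀)), ‖G σ‖ ≤ Γ σ := by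
    filter_upwards [hlimF] with σ hσ
    rw [Real.norm_eq_abs]
    exact le_of_tendsto' ((continuous_abs.tendsto _).comp hσ.1) fun N => hσ.2 N
  have hGi : IntegrableOn G (Ioo 0 t₀) volume := Integrable.mono' hΓi hGm hGΓ
  have hGi' : IntegrableOn G (Ioc 0 t₀) volume := (integrableOn_Ioc_iff_integrableOn_Ioo (f := G)).2 hGi
  -- ### the truncated pairings move by `∫ Σ_{|k|≤N} Re q`, which tends to `∫ G` (dominated convergence)
  have hInt : ∀ s₁ s₂, 0 < s₁ → s₁ ≤ s₂ → s₂ < t₀ →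
      Tendsto (fun N => (∑ k ∈ FunctionSpaces.Torus.freqBall N, (p k s₂).re) -
        ∑ k ∈ FunctionSpaces.Torus.freqBall N, (p k s₁).re) atTop (𝓝 (∫ σ in Ioc s₁ s₂, G σ)) := by
    intro s₁ s₂ h1 h12 h2
    have hsub : Ioc s₁ s₂ ⊆ Ioo 0 t₀ := fun σ hσ => ⟨h1.trans hσ.1, hσ.2.trans_lt h2⟩
    have hsub' : Ioc s₁ s₂ ⊆ Ioc 0 t₀ := fun σ hσ => ⟨h1.trans hσ.1, hσ.2.trans h2.le⟩
    have hdiff : ∀ N, (∑ k ∈ FunctionSpaces.Torus.freqBall N, (p k s₂).re) -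
        ∑ k ∈ FunctionSpaces.Torus.freqBall N, (p k s₁).re =
        ∫ σ in Ioc s₁ s₂, ∑ k ∈ FunctionSpaces.Torus.freqBall N, (q k σ).re := by
      intro N
      have hI : ∫ σ in Ioc s₁ s₂, ∑ k ∈ FunctionSpaces.Torus.freqBall N, (q k σ).re =
          ∑ k ∈ FunctionSpaces.Torus.freqBall N, ∫ σ in Ioc s₁ s₂, (q k σ).re :=
        integral_finsetSum _ fun k _ => ((hA k).1.mono_set hsub').re
      rw [hI, ← Finset.sum_sub_distrib]
      refine Finset.sum_congr rfl fun k _ => ?_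
      rw [← Complex.sub_re, (hA k).2 s₁ s₂ h1 h12 h2.le, re_integral_eq ((hA k).1.mono_set hsub')]
    have hae := ae_restrict_of_ae_restrict_of_subset hsub hlimF
    have hDCT := tendsto_integral_of_dominated_convergence Γ
      (fun N => ((hRqi N).mono_set hsub).aestronglyMeasurable) (hΓi.mono_set hsub)
      (fun N => hae.mono fun σ hσ => by rw [Real.norm_eq_abs]; exact hσ.2 N) (hae.mono fun σ hσ => hσ.1)
    exact hDCT.congr fun N => (hdiff N).symm
  -- ### Claim E: for a.e. `s`, the truncated pairings converge to `∫⟪u(s), ψ(t₀−s)⟫` (Parseval)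
  have hgood : ∀ᵐ s ∂(volume.restrict (Ioo 0 t₀)),
      Tendsto (fun N => ∑ k ∈ FunctionSpaces.Torus.freqBall N, (p k s).re) atTop
        (𝓝 (∫ x, ⟪u s x, ψ (t₀ - s) x⟫_ℝ)) := by
    filter_upwards [hB1u, hB1ψ, hB2ψ, h3] with s h1u h1ψ h2ψ h3s
    have hP := (FunctionSpaces.Torus.hasSum_re_inner_mFourierCoeff_complexify h3s.1.1 h3s.2.1).comp
      FunctionSpaces.Torus.tendsto_freqBall_atTop
    refine hP.congr fun N => ?_
    rw [Function.comp_apply]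
    refine Finset.sum_congr rfl fun k _ => ?_
    have hk : p k s = ⟪Xu k s, Xψ k (t₀ - s)⟫_ℂ := by
      rw [hp]
      simp only
      rw [← hpair k (Xu k s) (Xψ k (t₀ - s)) (h2ψ k)]
      exact Finset.sum_congr rfl fun i _ => by rw [h1u k i, h1ψ k i]
    rw [hk]
  -- ### conclusion: on the good set the pairing is `c + ∫_{(0,s]} G`
  have hμ : (ae (volume.restrict (Ioo (0 : ℝ) t₀))).NeBot := by
    rw [ae_neBot, Ne, Measure.restrict_eq_zero, Real.volume_Ioo, ENNReal.ofReal_eq_zero, not_le]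
    linarith
  obtain ⟨s₀, hs₀, hs₀I⟩ := (hgood.and (ae_restrict_mem measurableSet_Ioo)).exists
  have key : ∀ {a c : ℝ} {Ga Gc : ℝ}, 0 < a → a ≤ c → c < t₀ →
      Tendsto (fun N => ∑ k ∈ FunctionSpaces.Torus.freqBall N, (p k a).re) atTop (𝓝 Ga) →
      Tendsto (fun N => ∑ k ∈ FunctionSpaces.Torus.freqBall N, (p k c).re) atTop (𝓝 Gc) →
        Gc - Ga = ∫ σ in Ioc a c, G σ := by
    intro a c Ga Gc ha hac hc hta htc
    exact tendsto_nhds_unique (htc.sub hta) (hInt a c ha hac hc)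
  refine ⟨G, hGi, ?_, (∫ x, ⟪u s₀ x, ψ (t₀ - s₀) x⟫_ℝ) - ∫ σ in Ioc 0 s₀, G σ, ?_⟩
  · filter_upwards [hG] with σ hσ
    exact hσ.1.hasSum
  · filter_upwards [hgood, ae_restrict_mem measurableSet_Ioo] with s hs hsI
    rcases le_total s s₀ with hle | hle
    · have h := key hsI.1 hle hs₀I.2 hs hs₀
      have hsplit := setIntegral_Ioc_sub_setIntegral_Ioc₁₂ (hGi'.mono_set (Ioc_subset_Ioc_right hs₀I.2.le)) hsI.1.le hle
      linarith
    · have h := key hs₀I.1 hle hsI.2 hs₀ hs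
      have hsplit := setIntegral_Ioc_sub_setIntegral_Ioc₁₂ (hGi'.mono_set (Ioc_subset_Ioc_right hsI.2.le)) hs₀I.1.le hle
      linarith

/-- **Two-problem duality, endpoint form: the constant is the trace at both ends.** Under the hypotheses
of `exists_integrableOn_hasSum_cross`, with its `G` and `c`: `c = h(t₀)` for every continuous
representative `h` of `r ↦ ∫⟪ψ(r), u₀⟫` on `[0,t₀]`, and `g(t₀) = c + ∫_{(0,t₀]} G` for every continuous
representative `g` of `t ↦ ∫⟪u(t), φ⟫` on `[0,T]` (representatives exist by
`PassiveVectorTensorWeakContinuity.exists_continuousOn_integral_inner`): "`⟨u(t₀), φ⟩ − ⟨u₀, ψ(t₀)⟩ = ∫₀^{t₀} G`".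
The two limits `s ↑ t₀` and `s ↓ 0` use the strong `L²` initial traces of `ψ` and `u`
(`exists_modulus_integral_norm_sq_sub_of_nearIso`) against the energy bounds, the continuity of the
primitive of `G`, and an a.e. inequality between continuous functions holding at the endpoint.
[cite: Temam1984, Ch. III §1 Lemma 1.2 and Lemma 1.4] -/
theorem exists_integrableOn_hasSum_cross_traces (hu : IsWeakTensorPassiveVectorOn 0 T 𝔸₁ b₁ u₀ u)
    (ht₀ : 0 < t₀) (ht₀T : t₀ ≤ T)
    (hψ : IsWeakTensorPassiveVectorOn 0 t₀ (majorTranspose 𝔸₂) (fun r => -b₂ (t₀ - r)) φ ψ)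
    {lo hi : ℝ} (h𝔸₁ : NearIso 𝔸₁ lo hi) (h𝔸₂ : NearIso 𝔸₂ lo hi) (hlo : 0 < lo)
    (hu₀ : MemLp u₀ 2 volume) (hdivu₀ : FunctionSpaces.Torus.IsWeaklyDivFree u₀)
    (hφ : MemLp φ 2 volume) (hdivφ : FunctionSpaces.Torus.IsWeaklyDivFree φ)
    (hb₁ : MemLp (FunctionSpaces.Torus.stLift b₁) ∞ (volume.restrict (Ioo 0 T ×ˢ univ)))
    (hb₂ : MemLp (FunctionSpaces.Torus.stLift b₂) ∞ (volume.restrict (Ioo 0 T ×ˢ univ))) :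
    ∃ G : ℝ → ℝ, IntegrableOn G (Ioo 0 t₀) volume ∧
      (∀ᵐ σ ∂(volume.restrict (Ioo 0 t₀)), HasSum (fun k : d → ℤ =>
          ((-(4 * Real.pi ^ 2 : ℝ) : ℂ) *
              ⟪mFourierCoeff (FunctionSpaces.EuclideanSpace.complexify ∘ u σ) k,
                symbT 𝔸₁ k (mFourierCoeff (FunctionSpaces.EuclideanSpace.complexify ∘ ψ (t₀ - σ)) k)
                  - symbT 𝔸₂ k (mFourierCoeff (FunctionSpaces.EuclideanSpace.complexify ∘ ψ (t₀ - σ)) k)⟫_ℂ +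
            ∑ j, (2 * Real.pi * I * (k j)) *
              (⟪mFourierCoeff (FunctionSpaces.EuclideanSpace.complexify ∘ fun x => b₁ σ x j • u σ x) k,
                  mFourierCoeff (FunctionSpaces.EuclideanSpace.complexify ∘ ψ (t₀ - σ)) k⟫_ℂ -
                ⟪mFourierCoeff (FunctionSpaces.EuclideanSpace.complexify ∘ u σ) k,
                  mFourierCoeff (FunctionSpaces.EuclideanSpace.complexify ∘ fun x => b₂ σ x j • ψ (t₀ - σ) x) k⟫_ℂ)).re)
        (G σ)) ∧
      ∃ c : ℝ, (∀ᵐ s ∂(volume.restrict (Ioo 0 t₀)),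
          ∫ x, ⟪u s x, ψ (t₀ - s) x⟫_ℝ = c + ∫ σ in Ioc 0 s, G σ) ∧
        (∀ g : ℝ → ℝ, ContinuousOn g (Icc 0 T) →
          (∀ᵐ t ∂(volume.restrict (Ioo 0 T)), ∫ x, ⟪u t x, φ x⟫_ℝ = g t) → g t₀ = c + ∫ σ in Ioc 0 t₀, G σ) ∧
        (∀ h : ℝ → ℝ, ContinuousOn h (Icc 0 t₀) →
          (∀ᵐ r ∂(volume.restrict (Ioo 0 t₀)), ∫ x, ⟪ψ r x, u₀ x⟫_ℝ = h r) → h t₀ = c) := by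
  obtain ⟨G, hGi, hGsum, c, hc⟩ :=
    hu.exists_integrableOn_hasSum_cross ht₀ ht₀T hψ h𝔸₁ h𝔸₂ hlo hu₀ hdivu₀ hφ hdivφ hb₁ hb₂
  have hsubT : Ioo 0 t₀ ⊆ Ioo 0 T := Ioo_subset_Ioo le_rfl ht₀T
  have h𝔸₂' : NearIso (majorTranspose 𝔸₂) lo hi := (nearIso_majorTranspose_iff 𝔸₂ lo hi).2 h𝔸₂
  have hb₂' : MemLp (FunctionSpaces.Torus.stLift (fun r => -b₂ (t₀ - r))) ∞ (volume.restrict (Ioo 0 t₀ ×ˢ univ)) :=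
    memLp_top_stLift_reversed hb₂ ht₀T
  -- energy bounds and initial traces of `u` and `ψ`
  have hEu := hu.ae_integral_norm_sq_le h𝔸₁ hlo hu₀ hdivu₀ hb₁
  have hEψ := hψ.ae_integral_norm_sq_le h𝔸₂' hlo hφ hdivφ hb₂'
  obtain ⟨ωu, hωuc, hωu0, hωu⟩ := hu.exists_modulus_integral_norm_sq_sub_of_nearIso h𝔸₁ hlo hu₀ hdivu₀ hb₁
  obtain ⟨ωψ, hωψc, hωψ0, hωψ⟩ := hψ.exists_modulus_integral_norm_sq_sub_of_nearIso h𝔸₂' hlo hφ hdivφ hb₂'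
  -- the primitive of `G` is continuous on `[0,t₀]` and vanishes at `0`
  set P : ℝ → ℝ := fun s => ∫ σ in Ioc 0 s, G σ with hP
  have hGI : IntegrableOn G (Icc 0 t₀) volume := (integrableOn_Icc_iff_integrableOn_Ioo (f := G)).2 hGi
  have hPc : ContinuousOn P (Icc 0 t₀) := intervalIntegral.continuousOn_primitive hGI
  have hP0 : P 0 = 0 := by
    rw [hP]
    simp only [Ioc_self, Measure.restrict_empty, integral_zero_measure]
  -- Cauchy–Schwarz for the pairing of a difference (both factors in `L²`)
  have cs : ∀ {v w z : UnitAddTorus d → EuclideanSpace ℝ d}, MemLp v 2 volume → MemLp w 2 volume → MemLp z 2 volume →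
      |(∫ x, ⟪v x, z x⟫_ℝ) - ∫ x, ⟪w x, z x⟫_ℝ| ≤
        Real.sqrt (∫ x, ‖v x - w x‖ ^ 2) * Real.sqrt (∫ x, ‖z x‖ ^ 2) := by
    intro v w z hv hw hz
    have hi1 : Integrable (fun x => ⟪v x, z x⟫_ℝ) volume :=
      Integrable.mono' (hv.norm.integrable_mul hz.norm) (hv.1.inner hz.1) (ae_of_all _ fun _ => norm_inner_le_norm _ _)
    have hi2 : Integrable (fun x => ⟪w x, z x⟫_ℝ) volume :=
      Integrable.mono' (hw.norm.integrable_mul hz.norm) (hw.1.inner hz.1) (ae_of_all _ fun _ => norm_inner_le_norm _ _)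
    rw [← integral_sub hi1 hi2]
    simp_rw [← inner_sub_left]
    have hvw : MemLp (fun x => v x - w x) 2 volume := hv.sub hw
    have h1 : |∫ x, ⟪v x - w x, z x⟫_ℝ| ≤ ∫ x, ‖v x - w x‖ * ‖z x‖ := by
      rw [← Real.norm_eq_abs]
      exact (norm_integral_le_integral_norm _).trans (integral_mono_of_nonneg
        (ae_of_all _ fun x => norm_nonneg _) (hvw.norm.integrable_mul hz.norm)
        (ae_of_all _ fun x => norm_inner_le_norm _ _))
    have h2 := integral_mul_le_Lp_mul_Lq_of_nonneg Real.HolderConjugate.two_two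
      (ae_of_all _ fun x => norm_nonneg (v x - w x)) (ae_of_all _ fun x => norm_nonneg (z x))
      (by simpa using hvw.norm) (by simpa using hz.norm)
    refine h1.trans (h2.trans_eq ?_)
    simp only [Real.rpow_two, Real.sqrt_eq_rpow]
  refine ⟨G, hGi, hGsum, c, hc, fun g hgc hg => ?_, fun h hhc hh => ?_⟩
  · -- `s ↑ t₀`: `|c + P(s) − g(s)| ≤ √E₀ √ωψ(t₀ − s)` a.e., both sides continuous on `[0,t₀]`
    set E₀ : ℝ := ∫ x, ‖u₀ x‖ ^ 2 with hE₀
    have hae : ∀ᵐ s ∂(volume.restrict (Ioo 0 t₀)),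
        |c + P s - g s| - Real.sqrt E₀ * Real.sqrt (ωψ (t₀ - s)) ≤ 0 := by
      have hu' := ae_restrict_of_ae_restrict_of_subset hsubT ((hu.ae_memLp_two.and hEu).and hg)
      have hψ' := ae_restrict_Ioo_comp_sub_left₁₂ (hψ.ae_memLp_two.and hωψ)
      filter_upwards [hc, hu', hψ'] with s hcs hus hψs
      obtain ⟨⟨hu2, hEus⟩, hgs⟩ := hus
      obtain ⟨hψ2, hωs⟩ := hψs
      have hb1 := cs hψ2 hφ hu2
      have e1 : (∫ x, ⟪ψ (t₀ - s) x, u s x⟫_ℝ) = c + P s := by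
        rw [hP]
        dsimp only
        rw [← hcs]
        exact integral_congr_ae (ae_of_all _ fun x => real_inner_comm _ _)
      have e2 : (∫ x, ⟪φ x, u s x⟫_ℝ) = g s := by
        rw [← hgs]; exact integral_congr_ae (ae_of_all _ fun x => real_inner_comm _ _)
      rw [e1, e2] at hb1
      have hsq : Real.sqrt (∫ x, ‖u s x‖ ^ 2) ≤ Real.sqrt E₀ := Real.sqrt_le_sqrt hEus
      have hsq' : Real.sqrt (∫ x, ‖ψ (t₀ - s) x - φ x‖ ^ 2) ≤ Real.sqrt (ωψ (t₀ - s)) := Real.sqrt_le_sqrt hωs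
      nlinarith [hb1, hsq, hsq', Real.sqrt_nonneg (∫ x, ‖u s x‖ ^ 2), Real.sqrt_nonneg (ωψ (t₀ - s)),
        Real.sqrt_nonneg (∫ x, ‖ψ (t₀ - s) x - φ x‖ ^ 2), Real.sqrt_nonneg E₀]
    have hcont : ContinuousOn (fun s => |c + P s - g s| - Real.sqrt E₀ * Real.sqrt (ωψ (t₀ - s))) (Icc 0 t₀) := by
      refine (((continuousOn_const.add hPc).sub (hgc.mono (Icc_subset_Icc le_rfl ht₀T))).abs).sub
        (continuousOn_const.mul ((hωψc.comp (continuousOn_const.sub continuousOn_id) ?_).sqrt))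
      intro s hs
      show t₀ - s ∈ Icc 0 t₀
      exact ⟨by linarith [hs.2], by linarith [hs.1]⟩
    have h0 := nonpos_of_ae_nonpos_of_continuousOn₁₂ ht₀ hcont hae t₀ ⟨ht₀.le, le_rfl⟩
    simp only [sub_self, hωψ0, Real.sqrt_zero, mul_zero, sub_zero] at h0
    have h00 : |c + P t₀ - g t₀| = 0 := le_antisymm h0 (abs_nonneg _)
    rw [abs_eq_zero, sub_eq_zero] at h00
    exact h00.symm
  · -- `s ↓ 0`: `|c + P(s) − h(t₀ − s)| ≤ √ωu(s) √F₀` a.e., both sides continuous on `[0,t₀]`, `P(0) = 0`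
    set F₀ : ℝ := ∫ x, ‖φ x‖ ^ 2 with hF₀
    have hae : ∀ᵐ s ∂(volume.restrict (Ioo 0 t₀)),
        |c + P s - h (t₀ - s)| - Real.sqrt (ωu s) * Real.sqrt F₀ ≤ 0 := by
      have hu' := ae_restrict_of_ae_restrict_of_subset hsubT (hu.ae_memLp_two.and hωu)
      have hψ' := ae_restrict_Ioo_comp_sub_left₁₂ ((hψ.ae_memLp_two.and hEψ).and hh)
      filter_upwards [hc, hu', hψ'] with s hcs hus hψs
      obtain ⟨hu2, hωs⟩ := hus
      obtain ⟨⟨hψ2, hEψs⟩, hhs⟩ := hψs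
      have hb1 := cs hu2 hu₀ hψ2
      have e1 : (∫ x, ⟪u s x, ψ (t₀ - s) x⟫_ℝ) = c + P s := by
        rw [hP]
        dsimp only
        exact hcs
      have e2 : (∫ x, ⟪u₀ x, ψ (t₀ - s) x⟫_ℝ) = h (t₀ - s) := by
        rw [← hhs]; exact integral_congr_ae (ae_of_all _ fun x => real_inner_comm _ _)
      rw [e1, e2] at hb1
      have hsq : Real.sqrt (∫ x, ‖ψ (t₀ - s) x‖ ^ 2) ≤ Real.sqrt F₀ := Real.sqrt_le_sqrt hEψs
      have hsq' : Real.sqrt (∫ x, ‖u s x - u₀ x‖ ^ 2) ≤ Real.sqrt (ωu s) := Real.sqrt_le_sqrt hωs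
      nlinarith [hb1, hsq, hsq', Real.sqrt_nonneg (∫ x, ‖ψ (t₀ - s) x‖ ^ 2), Real.sqrt_nonneg (ωu s),
        Real.sqrt_nonneg (∫ x, ‖u s x - u₀ x‖ ^ 2), Real.sqrt_nonneg F₀]
    have hcont : ContinuousOn (fun s => |c + P s - h (t₀ - s)| - Real.sqrt (ωu s) * Real.sqrt F₀) (Icc 0 t₀) := by
      refine (((continuousOn_const.add hPc).sub (hhc.comp (continuousOn_const.sub continuousOn_id) ?_)).abs).sub
        (((hωuc.mono (Icc_subset_Icc le_rfl ht₀T)).sqrt).mul continuousOn_const)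
      intro s hs
      show t₀ - s ∈ Icc 0 t₀
      exact ⟨by linarith [hs.2], by linarith [hs.1]⟩
    have h0 := nonpos_of_ae_nonpos_of_continuousOn₁₂ ht₀ hcont hae 0 ⟨le_rfl, ht₀.le⟩
    simp only [sub_zero, hωu0, Real.sqrt_zero, zero_mul, hP0, add_zero] at h0
    have h00 : |c - h t₀| = 0 := le_antisymm h0 (abs_nonneg _)
    rw [abs_eq_zero, sub_eq_zero] at h00
    exact h00.symm

/-- **Two-problem duality with the SPLIT cross integrand (equal-carrier flux removed), a.e. and
endpoint forms.** As `exists_integrableOn_hasSum_cross_traces`, but at a.e. time `σ` the integrable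
function `G` is the sum of the family
`Re( −4π² ⟪û(σ)(k), (T_{𝔸₁}(k) − T_{𝔸₂}(k)) ψ̂(t₀−σ)(k)⟫ + Σⱼ 2πikⱼ ⟪𝓕((b₁ⱼ(σ) − b₂ⱼ(σ)) u(σ))(k), ψ̂(t₀−σ)(k)⟫ )`:
the transport cross term carries only the carrier DIFFERENCE `b₁ − b₂` on `u`, the flux of `b₂` on `u`
against `b₂` on `ψ` summing to zero by the `H¹` antisymmetry `Torus.hasSum_re_fourierFlux` at a.e. time
(`b₂(σ)` is weakly divergence free, `u(σ), ψ(t₀−σ)` have finite `‖∇·‖²`).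
[cite: Temam1984, Ch. III §1 Lemma 1.2 and Lemma 1.4] [cite: KuksinShirikyan2012, Prop. 2.1.7 (2.11)] -/
theorem exists_integrableOn_hasSum_cross_sub_traces (hu : IsWeakTensorPassiveVectorOn 0 T 𝔸₁ b₁ u₀ u)
    (ht₀ : 0 < t₀) (ht₀T : t₀ ≤ T)
    (hψ : IsWeakTensorPassiveVectorOn 0 t₀ (majorTranspose 𝔸₂) (fun r => -b₂ (t₀ - r)) φ ψ)
    {lo hi : ℝ} (h𝔸₁ : NearIso 𝔸₁ lo hi) (h𝔸₂ : NearIso 𝔸₂ lo hi) (hlo : 0 < lo)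
    (hu₀ : MemLp u₀ 2 volume) (hdivu₀ : FunctionSpaces.Torus.IsWeaklyDivFree u₀)
    (hφ : MemLp φ 2 volume) (hdivφ : FunctionSpaces.Torus.IsWeaklyDivFree φ)
    (hb₁ : MemLp (FunctionSpaces.Torus.stLift b₁) ∞ (volume.restrict (Ioo 0 T ×ˢ univ)))
    (hb₂ : MemLp (FunctionSpaces.Torus.stLift b₂) ∞ (volume.restrict (Ioo 0 T ×ˢ univ))) :
    ∃ G : ℝ → ℝ, IntegrableOn G (Ioo 0 t₀) volume ∧
      (∀ᵐ σ ∂(volume.restrict (Ioo 0 t₀)), HasSum (fun k : d → ℤ =>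
          ((-(4 * Real.pi ^ 2 : ℝ) : ℂ) *
              ⟪mFourierCoeff (FunctionSpaces.EuclideanSpace.complexify ∘ u σ) k,
                symbT 𝔸₁ k (mFourierCoeff (FunctionSpaces.EuclideanSpace.complexify ∘ ψ (t₀ - σ)) k)
                  - symbT 𝔸₂ k (mFourierCoeff (FunctionSpaces.EuclideanSpace.complexify ∘ ψ (t₀ - σ)) k)⟫_ℂ +
            ∑ j, (2 * Real.pi * I * (k j)) *
              ⟪mFourierCoeff (FunctionSpaces.EuclideanSpace.complexify ∘ fun x => (b₁ σ x j - b₂ σ x j) • u σ x) k,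
                  mFourierCoeff (FunctionSpaces.EuclideanSpace.complexify ∘ ψ (t₀ - σ)) k⟫_ℂ).re)
        (G σ)) ∧
      ∃ c : ℝ, (∀ᵐ s ∂(volume.restrict (Ioo 0 t₀)),
          ∫ x, ⟪u s x, ψ (t₀ - s) x⟫_ℝ = c + ∫ σ in Ioc 0 s, G σ) ∧
        (∀ g : ℝ → ℝ, ContinuousOn g (Icc 0 T) →
          (∀ᵐ t ∂(volume.restrict (Ioo 0 T)), ∫ x, ⟪u t x, φ x⟫_ℝ = g t) → g t₀ = c + ∫ σ in Ioc 0 t₀, G σ) ∧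
        (∀ h : ℝ → ℝ, ContinuousOn h (Icc 0 t₀) →
          (∀ᵐ r ∂(volume.restrict (Ioo 0 t₀)), ∫ x, ⟪ψ r x, u₀ x⟫_ℝ = h r) → h t₀ = c) := by
  obtain ⟨G, hGi, hGsum, c, hc, hg, hh⟩ :=
    hu.exists_integrableOn_hasSum_cross_traces ht₀ ht₀T hψ h𝔸₁ h𝔸₂ hlo hu₀ hdivu₀ hφ hdivφ hb₁ hb₂
  obtain ⟨M₁, M₂, -, hM₂, -, -, h3⟩ := ae_slice₁₂ hu ht₀T hψ h𝔸₁ h𝔸₂ hlo hu₀ hdivu₀ hφ hdivφ hb₁ hb₂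
  refine ⟨G, hGi, ?_, c, hc, hg, hh⟩
  filter_upwards [hGsum, h3] with σ hσ h3σ
  obtain ⟨⟨hu2, -, -, hb1u, hutop, -⟩, ⟨hψ2, hb2m, hb2M, hb2div, hψtop, -⟩⟩ := h3σ
  exact hasSum_cross_split₁₂ hM₂ hb2m hb2M hb2div hu2 hψ2 hutop hψtop hb1u hσ

/-- **Two-problem duality, `tsum` form**: for a.e. `s ∈ (0,t₀)`,
`∫⟪u(s), ψ(t₀−s)⟫ = c + ∫_{(0,s]} Σₖ Re( −4π² ⟪û,(T_{𝔸₁}−T_{𝔸₂})ψ̂⟫ + Σⱼ 2πikⱼ(⟪𝓕(b₁ⱼu),ψ̂⟫ − ⟪û,𝓕(b₂ⱼψ)⟫) ) dσ`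
(the mode sum converging absolutely at a.e. `σ` and being integrable in `σ`).
[cite: Temam1984, Ch. III §1 Lemma 1.2] -/
theorem exists_ae_integral_inner_reversed_eq_add_setIntegral_tsum (hu : IsWeakTensorPassiveVectorOn 0 T 𝔸₁ b₁ u₀ u)
    (ht₀ : 0 < t₀) (ht₀T : t₀ ≤ T)
    (hψ : IsWeakTensorPassiveVectorOn 0 t₀ (majorTranspose 𝔸₂) (fun r => -b₂ (t₀ - r)) φ ψ)
    {lo hi : ℝ} (h𝔸₁ : NearIso 𝔸₁ lo hi) (h𝔸₂ : NearIso 𝔸₂ lo hi) (hlo : 0 < lo)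
    (hu₀ : MemLp u₀ 2 volume) (hdivu₀ : FunctionSpaces.Torus.IsWeaklyDivFree u₀)
    (hφ : MemLp φ 2 volume) (hdivφ : FunctionSpaces.Torus.IsWeaklyDivFree φ)
    (hb₁ : MemLp (FunctionSpaces.Torus.stLift b₁) ∞ (volume.restrict (Ioo 0 T ×ˢ univ)))
    (hb₂ : MemLp (FunctionSpaces.Torus.stLift b₂) ∞ (volume.restrict (Ioo 0 T ×ˢ univ))) :
    ∃ c : ℝ, ∀ᵐ s ∂(volume.restrict (Ioo 0 t₀)),
      ∫ x, ⟪u s x, ψ (t₀ - s) x⟫_ℝ = c + ∫ σ in Ioc 0 s,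
        ∑' k : d → ℤ,
          ((-(4 * Real.pi ^ 2 : ℝ) : ℂ) *
              ⟪mFourierCoeff (FunctionSpaces.EuclideanSpace.complexify ∘ u σ) k,
                symbT 𝔸₁ k (mFourierCoeff (FunctionSpaces.EuclideanSpace.complexify ∘ ψ (t₀ - σ)) k)
                  - symbT 𝔸₂ k (mFourierCoeff (FunctionSpaces.EuclideanSpace.complexify ∘ ψ (t₀ - σ)) k)⟫_ℂ +
            ∑ j, (2 * Real.pi * I * (k j)) *
              (⟪mFourierCoeff (FunctionSpaces.EuclideanSpace.complexify ∘ fun x => b₁ σ x j • u σ x) k,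
                  mFourierCoeff (FunctionSpaces.EuclideanSpace.complexify ∘ ψ (t₀ - σ)) k⟫_ℂ -
                ⟪mFourierCoeff (FunctionSpaces.EuclideanSpace.complexify ∘ u σ) k,
                  mFourierCoeff (FunctionSpaces.EuclideanSpace.complexify ∘ fun x => b₂ σ x j • ψ (t₀ - σ) x) k⟫_ℂ)).re := by
  obtain ⟨G, -, hGsum, c, hc⟩ :=
    hu.exists_integrableOn_hasSum_cross ht₀ ht₀T hψ h𝔸₁ h𝔸₂ hlo hu₀ hdivu₀ hφ hdivφ hb₁ hb₂
  refine ⟨c, ?_⟩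
  have hae : ∀ᵐ σ ∂(volume.restrict (Ioc 0 t₀)), G σ =
      ∑' k : d → ℤ,
        ((-(4 * Real.pi ^ 2 : ℝ) : ℂ) *
            ⟪mFourierCoeff (FunctionSpaces.EuclideanSpace.complexify ∘ u σ) k,
              symbT 𝔸₁ k (mFourierCoeff (FunctionSpaces.EuclideanSpace.complexify ∘ ψ (t₀ - σ)) k)
                - symbT 𝔸₂ k (mFourierCoeff (FunctionSpaces.EuclideanSpace.complexify ∘ ψ (t₀ - σ)) k)⟫_ℂ +
          ∑ j, (2 * Real.pi * I * (k j)) *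
            (⟪mFourierCoeff (FunctionSpaces.EuclideanSpace.complexify ∘ fun x => b₁ σ x j • u σ x) k,
                mFourierCoeff (FunctionSpaces.EuclideanSpace.complexify ∘ ψ (t₀ - σ)) k⟫_ℂ -
              ⟪mFourierCoeff (FunctionSpaces.EuclideanSpace.complexify ∘ u σ) k,
                mFourierCoeff (FunctionSpaces.EuclideanSpace.complexify ∘ fun x => b₂ σ x j • ψ (t₀ - σ) x) k⟫_ℂ)).re := by
    rw [← Measure.restrict_congr_set (Ioo_ae_eq_Ioc (μ := (volume : Measure ℝ)) (a := (0 : ℝ)) (b := t₀))]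
    exact hGsum.mono fun σ hσ => hσ.tsum_eq.symm
  filter_upwards [hc, ae_restrict_mem measurableSet_Ioo] with s hs hsI
  rw [hs, integral_congr_ae (ae_restrict_of_ae_restrict_of_subset (Ioc_subset_Ioc_right hsI.2.le) hae)]

/-- **Two-problem duality with cross terms, split `tsum` form** (brick Z1′ of the one-level design
memo of cell `ad-ideate`, in its crux binder shape): for a.e. `s ∈ (0,t₀)`,
`∫⟪u(s), ψ(t₀−s)⟫ = c + ∫_{(0,s]} Σₖ Re( −4π² ⟪û(σ)(k),(T_{𝔸₁}(k)−T_{𝔸₂}(k))ψ̂(t₀−σ)(k)⟫ + Σⱼ 2πikⱼ ⟪𝓕((b₁ⱼ−b₂ⱼ)(σ)u(σ))(k), ψ̂(t₀−σ)(k)⟫ ) dσ`.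
With `𝔸₁ = 𝔸₂`, `b₁ = b₂` the integrand vanishes and this is
`exists_ae_integral_inner_reversed_eq_const`. [cite: Temam1984, Ch. III §1 Lemma 1.2]
[cite: KuksinShirikyan2012, Prop. 2.1.7 (2.11)] -/
theorem twoProblemDuality : ∀ {T t₀ : ℝ} {𝔸₁ 𝔸₂ : Visc4 d}
    {b₁ b₂ u ψ : ℝ → UnitAddTorus d → EuclideanSpace ℝ d} {u₀ φ : UnitAddTorus d → EuclideanSpace ℝ d},
    IsWeakTensorPassiveVectorOn 0 T 𝔸₁ b₁ u₀ u → 0 < t₀ → t₀ ≤ T →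
    IsWeakTensorPassiveVectorOn 0 t₀ (majorTranspose 𝔸₂) (fun r => -b₂ (t₀ - r)) φ ψ →
    ∀ {lo hi : ℝ}, NearIso 𝔸₁ lo hi → NearIso 𝔸₂ lo hi → 0 < lo →
    MemLp u₀ 2 volume → FunctionSpaces.Torus.IsWeaklyDivFree u₀ → MemLp φ 2 volume →
    FunctionSpaces.Torus.IsWeaklyDivFree φ →
    MemLp (FunctionSpaces.Torus.stLift b₁) ∞ (volume.restrict (Ioo 0 T ×ˢ univ)) →
    MemLp (FunctionSpaces.Torus.stLift b₂) ∞ (volume.restrict (Ioo 0 T ×ˢ univ)) →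
    ∃ c : ℝ, ∀ᵐ s ∂(volume.restrict (Ioo 0 t₀)),
      ∫ x, ⟪u s x, ψ (t₀ - s) x⟫_ℝ = c + ∫ σ in Ioc 0 s,
        ∑' k : d → ℤ,
          ((-(4 * Real.pi ^ 2 : ℝ) : ℂ) *
              ⟪mFourierCoeff (FunctionSpaces.EuclideanSpace.complexify ∘ u σ) k,
                symbT 𝔸₁ k (mFourierCoeff (FunctionSpaces.EuclideanSpace.complexify ∘ ψ (t₀ - σ)) k)
                  - symbT 𝔸₂ k (mFourierCoeff (FunctionSpaces.EuclideanSpace.complexify ∘ ψ (t₀ - σ)) k)⟫_ℂ +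
            ∑ j, (2 * Real.pi * I * (k j)) *
              ⟪mFourierCoeff (FunctionSpaces.EuclideanSpace.complexify ∘ fun x => (b₁ σ x j - b₂ σ x j) • u σ x) k,
                  mFourierCoeff (FunctionSpaces.EuclideanSpace.complexify ∘ ψ (t₀ - σ)) k⟫_ℂ).re := by
  intro T t₀ 𝔸₁ 𝔸₂ b₁ b₂ u ψ u₀ φ hu ht₀ ht₀T hψ lo hi h𝔸₁ h𝔸₂ hlo hu₀ hdivu₀ hφ hdivφ hb₁ hb₂
  obtain ⟨G, -, hGsum, c, hc, -, -⟩ :=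
    hu.exists_integrableOn_hasSum_cross_sub_traces ht₀ ht₀T hψ h𝔸₁ h𝔸₂ hlo hu₀ hdivu₀ hφ hdivφ hb₁ hb₂
  refine ⟨c, ?_⟩
  have hae : ∀ᵐ σ ∂(volume.restrict (Ioc 0 t₀)), G σ =
      ∑' k : d → ℤ,
        ((-(4 * Real.pi ^ 2 : ℝ) : ℂ) *
            ⟪mFourierCoeff (FunctionSpaces.EuclideanSpace.complexify ∘ u σ) k,
              symbT 𝔸₁ k (mFourierCoeff (FunctionSpaces.EuclideanSpace.complexify ∘ ψ (t₀ - σ)) k)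
                - symbT 𝔸₂ k (mFourierCoeff (FunctionSpaces.EuclideanSpace.complexify ∘ ψ (t₀ - σ)) k)⟫_ℂ +
          ∑ j, (2 * Real.pi * I * (k j)) *
            ⟪mFourierCoeff (FunctionSpaces.EuclideanSpace.complexify ∘ fun x => (b₁ σ x j - b₂ σ x j) • u σ x) k,
                mFourierCoeff (FunctionSpaces.EuclideanSpace.complexify ∘ ψ (t₀ - σ)) k⟫_ℂ).re := by
    rw [← Measure.restrict_congr_set (Ioo_ae_eq_Ioc (μ := (volume : Measure ℝ)) (a := (0 : ℝ)) (b := t₀))]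
    exact hGsum.mono fun σ hσ => hσ.tsum_eq.symm
  filter_upwards [hc, ae_restrict_mem measurableSet_Ioo] with s hs hsI
  rw [hs, integral_congr_ae (ae_restrict_of_ae_restrict_of_subset (Ioc_subset_Ioc_right hsI.2.le) hae)]

/-- **Two-problem duality, split endpoint form**: for every continuous representative `g` of
`t ↦ ∫⟪u(t), φ⟫` on `[0,T]` and `h` of `r ↦ ∫⟪ψ(r), u₀⟫` on `[0,t₀]`,
`g(t₀) − h(t₀) = ∫_{(0,t₀]} Σₖ Re( −4π² ⟪û(σ)(k),(T_{𝔸₁}(k)−T_{𝔸₂}(k))ψ̂(t₀−σ)(k)⟫ + Σⱼ 2πikⱼ ⟪𝓕((b₁ⱼ−b₂ⱼ)(σ)u(σ))(k), ψ̂(t₀−σ)(k)⟫ ) dσ`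
("`⟨u(t₀), φ⟩ − ⟨u₀, ψ(t₀)⟩ = ∫₀^{t₀}` cross terms"). [cite: Temam1984, Ch. III §1 Lemma 1.2 and Lemma 1.4]
[cite: KuksinShirikyan2012, Prop. 2.1.7 (2.11)] -/
theorem twoProblemDuality_traces (hu : IsWeakTensorPassiveVectorOn 0 T 𝔸₁ b₁ u₀ u)
    (ht₀ : 0 < t₀) (ht₀T : t₀ ≤ T)
    (hψ : IsWeakTensorPassiveVectorOn 0 t₀ (majorTranspose 𝔸₂) (fun r => -b₂ (t₀ - r)) φ ψ)
    {lo hi : ℝ} (h𝔸₁ : NearIso 𝔸₁ lo hi) (h𝔸₂ : NearIso 𝔸₂ lo hi) (hlo : 0 < lo)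
    (hu₀ : MemLp u₀ 2 volume) (hdivu₀ : FunctionSpaces.Torus.IsWeaklyDivFree u₀)
    (hφ : MemLp φ 2 volume) (hdivφ : FunctionSpaces.Torus.IsWeaklyDivFree φ)
    (hb₁ : MemLp (FunctionSpaces.Torus.stLift b₁) ∞ (volume.restrict (Ioo 0 T ×ˢ univ)))
    (hb₂ : MemLp (FunctionSpaces.Torus.stLift b₂) ∞ (volume.restrict (Ioo 0 T ×ˢ univ)))
    {g h : ℝ → ℝ} (hgc : ContinuousOn g (Icc 0 T))
    (hg : ∀ᵐ t ∂(volume.restrict (Ioo 0 T)), ∫ x, ⟪u t x, φ x⟫_ℝ = g t)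
    (hhc : ContinuousOn h (Icc 0 t₀))
    (hh : ∀ᵐ r ∂(volume.restrict (Ioo 0 t₀)), ∫ x, ⟪ψ r x, u₀ x⟫_ℝ = h r) :
    g t₀ - h t₀ = ∫ σ in Ioc 0 t₀,
        ∑' k : d → ℤ,
          ((-(4 * Real.pi ^ 2 : ℝ) : ℂ) *
              ⟪mFourierCoeff (FunctionSpaces.EuclideanSpace.complexify ∘ u σ) k,
                symbT 𝔸₁ k (mFourierCoeff (FunctionSpaces.EuclideanSpace.complexify ∘ ψ (t₀ - σ)) k)
                  - symbT 𝔸₂ k (mFourierCoeff (FunctionSpaces.EuclideanSpace.complexify ∘ ψ (t₀ - σ)) k)⟫_ℂ +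
            ∑ j, (2 * Real.pi * I * (k j)) *
              ⟪mFourierCoeff (FunctionSpaces.EuclideanSpace.complexify ∘ fun x => (b₁ σ x j - b₂ σ x j) • u σ x) k,
                  mFourierCoeff (FunctionSpaces.EuclideanSpace.complexify ∘ ψ (t₀ - σ)) k⟫_ℂ).re := by
  obtain ⟨G, -, hGsum, c, -, hg', hh'⟩ :=
    hu.exists_integrableOn_hasSum_cross_sub_traces ht₀ ht₀T hψ h𝔸₁ h𝔸₂ hlo hu₀ hdivu₀ hφ hdivφ hb₁ hb₂
  have e1 := hg' g hgc hg
  have e2 := hh' h hhc hh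
  have hae : ∀ᵐ σ ∂(volume.restrict (Ioc 0 t₀)), G σ =
      ∑' k : d → ℤ,
        ((-(4 * Real.pi ^ 2 : ℝ) : ℂ) *
            ⟪mFourierCoeff (FunctionSpaces.EuclideanSpace.complexify ∘ u σ) k,
              symbT 𝔸₁ k (mFourierCoeff (FunctionSpaces.EuclideanSpace.complexify ∘ ψ (t₀ - σ)) k)
                - symbT 𝔸₂ k (mFourierCoeff (FunctionSpaces.EuclideanSpace.complexify ∘ ψ (t₀ - σ)) k)⟫_ℂ +
          ∑ j, (2 * Real.pi * I * (k j)) *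
            ⟪mFourierCoeff (FunctionSpaces.EuclideanSpace.complexify ∘ fun x => (b₁ σ x j - b₂ σ x j) • u σ x) k,
                mFourierCoeff (FunctionSpaces.EuclideanSpace.complexify ∘ ψ (t₀ - σ)) k⟫_ℂ).re := by
    rw [← Measure.restrict_congr_set (Ioo_ae_eq_Ioc (μ := (volume : Measure ℝ)) (a := (0 : ℝ)) (b := t₀))]
    exact hGsum.mono fun σ hσ => hσ.tsum_eq.symm
  rw [e1, e2, ← integral_congr_ae hae]
  ring

end IsWeakTensorPassiveVectorOn

end Torus

end Literature.Analysis.FluidPDE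

end
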